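import Literature.MathematicalPhysics.QuantumFieldTheory.SU2HighTemperaturePeierlsReduction
import Literature.Probability.LatticeModels.ChessboardEstimateEvenTorus
import HarnessLib

/-!
# Tomboulis–Yaffe 1985, (2.6)–(2.7) and (3.9)–(3.10): the chessboard estimates for site and bond functions of
# the Polyakov loops on the finite-temperature lattice, proved; the disorder bounds (3.25)–(3.26) reduced to
# thermodynamic pattern bounds at zero magnetic coupling

Topic `Literature/MathematicalPhysics/QuantumFieldTheory`; third companion of
`SU2HighTemperatureNonConfinement.lean` (the named facts `PolyakovTwoPointLowerBound`,
`MagneticFluxFreeEnergyBound` = Theorems I–II of E. T. Tomboulis, L. G. Yaffe, *Finite temperature SU(2)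
lattice gauge theory*, Commun. Math. Phys. **100** (1985) 313–341 [TomboulisYaffe1985]) and of
`SU2HighTemperaturePeierlsReduction.lean` (Theorems I–II reduced to the disorder bounds (3.25)–(3.26)).
The remaining layer of TY's proof, §III.C "Disorder probabilities", BEGINS with the chessboard estimate
(p. 323: "We begin by using the chessboard estimates (2.6) and (2.7) to bound these local expectations by
thermodynamic quantities", (3.9)–(3.10)). This file proves the SITE version (2.6) ⟹ (3.9) on
Borgs–Seiler's finite-temperature lattice `ℤ_{L₀} × (ℤ/L_s)^d` of
`Literature.Barriers.QuantumFields.FiniteTemperature`, for every even spatial side `L_s = 2n + 2`,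
every compact group `G`, continuous unitary `ρ` and Wilson couplings `J_E, J_M ≥ 0`:

* ★ `expectation_polyakovProd_le_rpow` — TY (2.6) for one function ("By repeatedly using reflection
  positivity for timelike planes in between lattice sites, one may derive the chessboard estimate
  `⟨∏_{x∈Λ_s} f_x(S_x)⟩ ≤ ∏_{y∈Λ_s} ⟨∏_{x∈Λ_s} f_y(S_x)⟩^{1/|Λ_s|}`", p. 315), in the form used in
  (3.9): for a measurable `f : G → [0,1]` with `⟨∏_x f(Ω[x])⟩ > 0` and every set of sites `T`,
  `⟨∏_{x∈T} f(Ω[x])⟩ ≤ ⟨∏_{x} f(Ω[x])⟩^{|T|/L_s^d}` (`Ω[x]` = `polyakovLine`, the time-ordered product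
  of the time-like links above `x`, a function of TY's `S_x`);
* ★ `expectation_polyakov_le_rpow` — the one-site case `⟨f(Ω[x])⟩ ≤ ⟨∏_y f(Ω[y])⟩^{1/L_s^d}`, the
  shape of TY (3.9) (`f = 1 − |½trΩ|^α`).

Architecture (Fröhlich–Israel–Lieb–Simon, Thm. 4.1; Friedli–Velenik, Thm. 10.11, for the torus of
blocks of side `B = 1`): the tree already proves the ABSTRACT chessboard estimate on a block torus of any
even side — `Literature.Probability.LatticeModels.chessboard_le_rpow_even`: a set function `ψ ≥ 0` with
`ψ ∅ ≤ 1`, `ψ univ > 0` and the reflection Cauchy–Schwarz inequalities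
`ψ S ^ 2 ≤ ψ (symP i k S) · ψ (symM i k S)` for the reflections `θ_{i,k} : c ↦ c[i ↦ 2k−1−c_i]`
through all "bond" hyperplanes `x_i = k − ½` satisfies `ψ S ≤ ψ univ ^ (|S|/N^d)` — and reflection
positivity of the finite-temperature Wilson weight in the spatial bond planes `x_i = ½`, `x_i = ½ + L_s/2`
(`FiniteTemperature.integral_mul_conj_spaceReflect_mul_weight_nonneg`, Borgs–Seiler / Osterwalder–Seiler;
these are TY's "timelike planes in between lattice sites"). What this file supplies:

* §1 the Wilson weight is INVARIANT under the bond reflection (`weight_spaceReflect`; the tree had the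
  covariance of the slice sums, not the invariance of the total action), the reflections
  `Θ_{i,k} = τ_{−(k−1)e_i} ∘ θ ∘ τ_{(k−1)e_i}` in ALL bond planes (`reflAt`) by conjugating the tree's
  `spaceReflect i` with its translations, `Ω[c](Θ_{i,k}U) = Ω[θ_{i,k}c](U)` (`polyakovLine_reflAt`),
  and the change of variables `∫ X·(Y∘Θ_{i,k}) e^{−S} = ∫ (X∘τ)·(Y∘τ∘θ) e^{−S}` (`integral_reflAt`);
* §2 the Cauchy–Schwarz inequality of the OS form, TY (2.5) `|⟨FΘG⟩| ≤ ⟨FΘF⟩^{1/2}⟨GΘG⟩^{1/2}`, for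
  real bounded measurable `F, G` depending on the positive links (`sq_integral_mul_spaceReflect_le`:
  positivity of the form on `F + tG`, its symmetry by the measure-preserving weight-preserving
  reflection, discriminant);
* §3 the assembly: `ψ T := ⟨∏_{c∈T} f(Ω[c])⟩`; for the plane `(i,k)` split `T = T₋ ∪ T₊` along the
  halves of `θ_{i,k}`, write `∏_T = F · (G ∘ Θ_{i,k})` with `F = ∏_{T₋} f(Ω[c])`,
  `G = ∏_{c∈T₊} f(Ω[θ_{i,k}c])`, so that `ψ(symM T) = ⟨F(F∘Θ)⟩`, `ψ(symP T) = ⟨G(G∘Θ)⟩`; after the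
  translation by `−(k−1)e_i` both `F` and `G` depend only on time-like links at sites of the positive
  half `{−n ≤ x_i ≤ 0}` of the base reflection (`dependsOn_prod_translate`, the arithmetic
  `val_neg_sub_le`), and §2 gives `hcs`; `h0`, `hempty` (`ψ ∅ = 1`), `h1 = ⟨∏ f⟩ > 0` are immediate.

§§4–8 (appended) add the BOND version and the assembly of TY's §III.C up to its thermodynamic estimate:

* §4 the site reflections `Σ_{i,k}` in ALL lattice planes `x_i = k` (conjugates of the tree's `spaceSiteReflect`),
  `Ω[c](Σ_{i,k}U) = Ω[c[i ↦ 2k − c_i]](U)`, invariance of the weight, and the Cauchy–Schwarz inequality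
  `sq_integral_mul_spaceSiteReflect_le` from the tree's site-plane reflection positivity
  (`integral_mul_conj_spaceSiteReflect_mul_weight_nonneg`, `L_s ≥ 4`);
* §5 ★ `expectation_polyakovBondProd_le_rpow` — TY (2.7) ⟹ (3.10) for ONE symmetric bond function `f` and the
  bonds of ONE axis `i`: `⟨∏_{c∈T} f(Ω[c], Ω[c+e_i])⟩ ≤ ⟨∏_{c} f(Ω[c], Ω[c+e_i])⟩^{|T|/L_s^d}`. TY derive (2.7) from
  "reflections in timelike planes through lattice sites plus timelike dihedral planes"; dihedral-plane reflection
  positivity is not in the tree, and is AVOIDED here: the direction-`i` bonds, indexed by their base points, are the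
  cells of the arrangement of the lattice planes `x_i = k` and the bond planes `x_j = k − ½` (`j ≠ i`), on which
  both kinds of reflections act by the tree's `cellReflect`, so that `chessboard_le_rpow_even` applies verbatim
  (§4 for the axis `i`, §2 for the others). The majorant is the pattern staggered along the axis `i` (instead of
  TY's checkerboard `∏_{x even} P⁺_x ∏_{y odd} P⁻_y`), which serves the Peierls bound (3.6) equally well;
* §6 positivity of the pattern expectations (`∏dg` charges open sets; explicit witnesses);
* §7–8 ★★ `disorderBounds_of_patternBounds`: the hypothesis `X` of
  `polyakovTwoPointLowerBound_of_disorderBounds` ∕ `magneticFluxFreeEnergyBound_of_disorderBounds` (TY (3.25)–(3.26),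
  for every bond set `B`, uniformly in `L_s`) FOLLOWS from two full-lattice pattern bounds per box —
  `⟨∏_x (1 − |½trΩ[x]|)⟩ ≤ K^{L_s^d}` (TY (3.23)) and `⟨every bond ⟨y, y+e_i⟩ is a domain wall⟩ ≤ K^{d L_s^d}` for
  each axis (one-axis form of TY (3.24)) — and ★★ `disorderBounds_of_electricPatternBounds`: these may be taken at
  ZERO magnetic coupling (`expectation_le_exp_mul_expectation_electric`: `⟨F⟩_{J_E,J_M} ≤ e^{2J_M·N·#sites·#{i<j}}⟨F⟩_{J_E,0}`,
  harmless after the `L_s^d`-th root along `J_M = γ/θ → 0`), where the space-like links integrate exactly (TY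
  (3.16)) and the model is an `SU(2)`-spin model of Polyakov loops.

What remains of TY's §III.C after this file (honest scope): the thermodynamic estimate itself at `J_M = 0` — the
transfer-matrix time decimation (3.11)–(3.15) of App. III and the one-slice comparison bounds (3.16)–(3.24) of
App. IV — i.e. the hypothesis of `disorderBounds_of_electricPatternBounds`. No named fact is introduced or
discharged here; the consumer is the typed prerequisite `TY85DisorderBounds` of `SU2HighTemperaturePeierlsReduction`.

## References

* E. T. Tomboulis, L. G. Yaffe, Commun. Math. Phys. 100 (1985) 313–341, §II.A (2.4)–(2.7) (pp. 315–316),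
  §III.C (3.9)–(3.10), (3.16), (3.23)–(3.26) (pp. 323–325), App. III.A (p. 334) [TomboulisYaffe1985].
* J. Fröhlich, R. Israel, E. H. Lieb, B. Simon, Commun. Math. Phys. 62 (1978) 1–34, Thm. 2.1 (Schwarz
  inequality), Thm. 4.1 (chessboard estimate) [FrohlichIsraelLiebSimon1978].
* S. Friedli, Y. Velenik, *Statistical Mechanics of Lattice Systems*, CUP 2017, §10.3 (reflections
  through edges, eq. (10.1)), Thm. 10.11 (chessboard estimate, §10.4) [FriedliVelenik2017].
* C. Borgs, E. Seiler, Commun. Math. Phys. 91 (1983) 329–380, §II.2 (reflection positivity of the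
  finite-temperature lattice gauge theory) [BorgsSeiler1983].
-/

noncomputable section

open MeasureTheory Filter Finset
open scoped Topology BigOperators ComplexConjugate ComplexOrder
open Literature.Barriers.QuantumFields Literature.Barriers.QuantumFields.FiniteTemperature
open Literature.Barriers.CriticalPhenomena.NonGibbs (BlockIdx cellReflect halfPlus halfMinus symP symM
  mem_halfPlus mem_halfMinus cellReflect_apply cellReflect_cellReflect cellReflect_apply_same_sub
  cellReflect_apply_of_ne disjoint_halfPlus_halfMinus mem_halfPlus_or_mem_halfMinus cellReflect_mem_halfMinus
  cellReflect_mem_halfPlus zmod_val_neg_sub_one)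
open Literature.Probability.LatticeModels (chessboard_le_rpow_even)

namespace Literature.MathematicalPhysics.QuantumFieldTheory

namespace TomboulisYaffeHighTemperature

/-! ### §1 The bond reflection preserves the Wilson weight; the conjugated reflections `Θ_{i,k}` -/

section Reflection

variable {d L₀ L : ℕ} [NeZero L₀] [NeZero L] {G : Type*} [Group G] {N : ℕ}
  (ρ : G →* Matrix (Fin N) (Fin N) ℂ)

/-- **The finite-temperature Wilson action is invariant under the spatial bond reflection** (unitary
`ρ`): the in-slice sums are permuted `j ↦ 1 − j`, the cross-slice sums `j ↦ −j`. [cite: BorgsSeiler1983, §II.2 (pp. 331–332)] -/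
theorem minusAction_spaceReflect (hρu : ∀ g, ρ g ∈ Matrix.unitaryGroup (Fin N) ℂ) (JE JM : ℝ) (i : Fin d)
    (U : Config d L₀ L G) : minusAction ρ JE JM (spaceReflect i U) = minusAction ρ JE JM U := by
  rw [minusAction_eq_sum_dirSlices ρ JE JM i, minusAction_eq_sum_dirSlices ρ JE JM i U]
  simp_rw [inSlice_spaceReflect, crossSlice_spaceReflect ρ hρu]
  rw [Finset.sum_add_distrib, Finset.sum_add_distrib]
  congr 1
  · exact Fintype.sum_equiv (Equiv.subLeft 1) _ _ fun j => by simp [Equiv.subLeft]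
  · exact Fintype.sum_equiv (Equiv.neg (ZMod L)) _ _ fun j => by simp

/-- Hence the Boltzmann weight is reflection invariant. [cite: BorgsSeiler1983, §II.2 (pp. 331–332)] -/
theorem weight_spaceReflect (hρu : ∀ g, ρ g ∈ Matrix.unitaryGroup (Fin N) ℂ) (JE JM : ℝ) (i : Fin d)
    (U : Config d L₀ L G) : weight ρ JE JM (spaceReflect i U) = weight ρ JE JM U := by
  rw [weight, weight, minusAction_spaceReflect ρ hρu]

omit [NeZero L₀] [NeZero L] [Group G] in
/-- Composition of spatial translations. [folklore] -/
private theorem translate_translate (a b : Fin d → ZMod L) (U : Config d L₀ L G) :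
    translate a (translate b U) = translate (a + b) U := by
  funext e
  rcases e with ⟨⟨t, x⟩, μ⟩
  simp only [translate_apply, add_assoc]

omit [NeZero L₀] [NeZero L] [Group G] in
/-- The trivial translation. [folklore] -/
private theorem translate_zero (U : Config d L₀ L G) : translate (0 : Fin d → ZMod L) U = U := by
  funext e
  rcases e with ⟨⟨t, x⟩, μ⟩
  simp only [translate_apply, add_zero]

/-- **The reflection in the bond planes `x_i = k − ½`, `x_i = k − ½ + L/2`**, obtained from the tree's
`spaceReflect i` (planes `x_i = ½`, `x_i = ½ + L/2`) by conjugation with the translation by `(k−1)e_i`.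
[cite: FriedliVelenik2017, §10.3 eq. (10.1) (reflections through edges)] -/
def reflAt (i : Fin d) (k : ZMod L) (U : Config d L₀ L G) : Config d L₀ L G :=
  translate (-(Pi.single i (k - 1))) (spaceReflect i (translate (Pi.single i (k - 1)) U))

omit [NeZero L₀] [NeZero L] in
/-- **Polyakov loops under `Θ_{i,k}`**: `Ω[c](Θ_{i,k} U) = Ω[θ_{i,k} c](U)` with `θ_{i,k} c = c[i ↦ 2k−1−c_i]`
the tree's `cellReflect`. [cite: FriedliVelenik2017, §10.3 eq. (10.1)] -/
theorem polyakovLine_reflAt (i : Fin d) (k : ZMod L) (U : Config d L₀ L G) (c : Fin d → ZMod L) :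
    polyakovLine (reflAt i k U) c = polyakovLine U (cellReflect i k c) := by
  rw [reflAt, polyakovLine_translate, polyakovLine_spaceReflect, polyakovLine_translate]
  congr 1
  funext j
  simp only [cellReflect_apply, Pi.add_apply]
  by_cases hj : j = i
  · subst hj
    simp only [bondRefl_apply_same, Pi.add_apply, Pi.neg_apply, Pi.single_eq_same, Function.update_self]
    ring
  · simp only [bondRefl_apply_of_ne hj, Pi.add_apply, Pi.neg_apply, Pi.single_eq_of_ne hj,
      Function.update_of_ne hj, neg_zero, add_zero]

omit [NeZero L₀] [NeZero L] in
/-- `Θ_{i,k}` after the inverse translation: `Θ_{i,k}(τ_{−a} V) = τ_{−a}(θ V)`, `a = (k−1)e_i`. [folklore] -/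
private theorem reflAt_translate_neg (i : Fin d) (k : ZMod L) (V : Config d L₀ L G) :
    reflAt i k (translate (-(Pi.single i (k - 1))) V) =
      translate (-(Pi.single i (k - 1))) (spaceReflect i V) := by
  rw [reflAt, translate_translate, add_neg_cancel, translate_zero]

variable [TopologicalSpace G] [IsTopologicalGroup G] [CompactSpace G] [MeasurableSpace G] [BorelSpace G]
  [SecondCountableTopology G]

omit [SecondCountableTopology G] in
/-- **Change of variables for the conjugated reflection**:
`∫ X(U) Y(Θ_{i,k}U) e^{−S(U)} = ∫ X(τ_{−a}V) Y(τ_{−a}θV) e^{−S(V)}` (translation invariance of `∏dg` and of the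
weight). [cite: FriedliVelenik2017, §10.4.1 (proof of Thm. 10.11, `B`-periodicity)] -/
private theorem integral_reflAt (JE JM : ℝ) (i : Fin d) (k : ZMod L) (X Y : Config d L₀ L G → ℝ) :
    ∫ U, X U * Y (reflAt i k U) * weight ρ JE JM U ∂haar d L₀ L G =
      ∫ V, X (translate (-(Pi.single i (k - 1))) V) *
        Y (translate (-(Pi.single i (k - 1))) (spaceReflect i V)) * weight ρ JE JM V ∂haar d L₀ L G := by
  have hmp := measurePreserving_translateEquiv (d := d) (L₀ := L₀) (L := L) (G := G) (-(Pi.single i (k - 1)))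
  have h := hmp.integral_comp' (fun U : Config d L₀ L G => X U * Y (reflAt i k U) * weight ρ JE JM U)
  rw [coe_translateEquiv] at h
  rw [← h]
  refine integral_congr_ae (Eventually.of_forall fun V => ?_)
  simp only [reflAt_translate_neg, weight_translate]

/-- The bond reflection as a measurable equivalence (an involution). [folklore] -/
private def spaceReflectMEquiv (i : Fin d) : Config d L₀ L G ≃ᵐ Config d L₀ L G where
  toFun := spaceReflect i
  invFun := spaceReflect i
  left_inv := spaceReflect_spaceReflect i
  right_inv := spaceReflect_spaceReflect i
  measurable_toFun := (continuous_spaceReflect i).measurable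
  measurable_invFun := (continuous_spaceReflect i).measurable

/-- Change of variables by the bond reflection. [folklore] -/
private theorem integral_comp_spaceReflect (i : Fin d) (f : Config d L₀ L G → ℝ) :
    ∫ U, f (spaceReflect i U) ∂haar d L₀ L G = ∫ U, f U ∂haar d L₀ L G := by
  have hmp : MeasurePreserving (spaceReflectMEquiv (d := d) (L₀ := L₀) (L := L) (G := G) i)
      (haar d L₀ L G) (haar d L₀ L G) := measurePreserving_spaceReflect i
  exact hmp.integral_comp' f

end Reflection

/-! ### §2 Reflection positivity ⇒ Cauchy–Schwarz in the bond planes -/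

section CS

variable {d L₀ n : ℕ} [NeZero L₀] {G : Type*} [Group G] [TopologicalSpace G] [IsTopologicalGroup G]
  [CompactSpace G] [MeasurableSpace G] [BorelSpace G] [SecondCountableTopology G] {N : ℕ}
  (ρ : G →* Matrix (Fin N) (Fin N) ℂ)

/-- Products against a reflected observable are integrable against the weight. [folklore] -/
private theorem integrable_mul_refl_mul_weight (hρ : Continuous ρ) (JE JM : ℝ) (i : Fin d)
    {F G' : Config d L₀ (2 * n + 2) G → ℝ} (hFm : Measurable F) (hGm : Measurable G') {KF KG : ℝ}
    (hFb : ∀ U, |F U| ≤ KF) (hGb : ∀ U, |G' U| ≤ KG) :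
    Integrable (fun U => F U * G' (spaceReflect i U) * weight ρ JE JM U) (haar d L₀ (2 * n + 2) G) := by
  refine integrable_mul_weight ρ hρ JE JM
    ((hFm.mul (hGm.comp (continuous_spaceReflect i).measurable)).aestronglyMeasurable) (C := KF * KG) fun U => ?_
  rw [abs_mul]
  exact mul_le_mul (hFb U) (hGb _) (abs_nonneg _) ((abs_nonneg _).trans (hFb U))

/-- **Cauchy–Schwarz of the Osterwalder–Schrader form in the spatial bond planes** `x_i = ½`, `x_i = ½ + L/2`
(TY (2.5); the tree's positivity `integral_mul_conj_spaceReflect_mul_weight_nonneg` on `F + tG`, the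
symmetry of the form from the reflection invariance of `∏dg e^{−S}`, and the discriminant):
`(∫ F·(G∘θ) e^{−S})² ≤ (∫ F·(F∘θ) e^{−S}) (∫ G·(G∘θ) e^{−S})` for real bounded measurable `F, G` depending on
the positive links. [cite: TomboulisYaffe1985, §II.A eqs. (2.4)–(2.5) (p. 315)] [cite: FrohlichIsraelLiebSimon1978, Thm. 2.1] -/
theorem sq_integral_mul_spaceReflect_le (hρu : ∀ g, ρ g ∈ Matrix.unitaryGroup (Fin N) ℂ) (hρ : Continuous ρ)
    {JE JM : ℝ} (hJE : 0 ≤ JE) (hJM : 0 ≤ JM) (i : Fin d) {F G' : Config d L₀ (2 * n + 2) G → ℝ}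
    (hFm : Measurable F) (hGm : Measurable G') {KF KG : ℝ} (hFb : ∀ U, |F U| ≤ KF) (hGb : ∀ U, |G' U| ≤ KG)
    (hFd : DependsOn F ((bondPos d L₀ n i : Finset _) : Set _))
    (hGd : DependsOn G' ((bondPos d L₀ n i : Finset _) : Set _)) :
    (∫ U, F U * G' (spaceReflect i U) * weight ρ JE JM U ∂haar d L₀ (2 * n + 2) G) ^ 2 ≤
      (∫ U, F U * F (spaceReflect i U) * weight ρ JE JM U ∂haar d L₀ (2 * n + 2) G) *
        (∫ U, G' U * G' (spaceReflect i U) * weight ρ JE JM U ∂haar d L₀ (2 * n + 2) G) := by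
  set μ := haar d L₀ (2 * n + 2) G with hμ
  set w : Config d L₀ (2 * n + 2) G → ℝ := fun U => weight ρ JE JM U with hw
  set σ : Config d L₀ (2 * n + 2) G → Config d L₀ (2 * n + 2) G := spaceReflect i with hσ
  set A : ℝ := ∫ U, F U * F (σ U) * w U ∂μ with hA
  set B : ℝ := ∫ U, F U * G' (σ U) * w U ∂μ with hB
  set B' : ℝ := ∫ U, G' U * F (σ U) * w U ∂μ with hB'
  set C : ℝ := ∫ U, G' U * G' (σ U) * w U ∂μ with hC
  -- reflection positivity of the real combinations `s F + t G`
  have hRP : ∀ s t : ℝ, 0 ≤ ∫ U, (s * F U + t * G' U) * (s * F (σ U) + t * G' (σ U)) * w U ∂μ := by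
    intro s t
    set O : Config d L₀ (2 * n + 2) G → ℂ := fun U => ((s * F U + t * G' U : ℝ) : ℂ) with hO
    have hOm : Measurable O :=
      Complex.measurable_ofReal.comp ((measurable_const.mul hFm).add (measurable_const.mul hGm))
    have hOb : ∀ U, ‖O U‖ ≤ |s| * KF + |t| * KG := fun U => by
      rw [hO, Complex.norm_real, Real.norm_eq_abs]
      calc |s * F U + t * G' U| ≤ |s * F U| + |t * G' U| := abs_add_le _ _
        _ = |s| * |F U| + |t| * |G' U| := by rw [abs_mul, abs_mul]
        _ ≤ |s| * KF + |t| * KG := add_le_add (mul_le_mul_of_nonneg_left (hFb U) (abs_nonneg s))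
            (mul_le_mul_of_nonneg_left (hGb U) (abs_nonneg t))
    have hOd : DependsOn O ((bondPos d L₀ n i : Finset _) : Set _) :=
      fun U V hUV => by simp only [hO, hFd hUV, hGd hUV]
    have h := integral_mul_conj_spaceReflect_mul_weight_nonneg ρ hρu hρ hJE hJM i hOm hOb hOd
    have hint : (fun U => O U * conj (O (spaceReflect i U)) * (weight ρ JE JM U : ℂ)) =
        fun U => (((s * F U + t * G' U) * (s * F (σ U) + t * G' (σ U)) * w U : ℝ) : ℂ) := by
      funext U; simp only [hO, hσ, hw, Complex.conj_ofReal]; push_cast; ring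
    rw [hint, integral_complex_ofReal] at h
    exact Complex.zero_le_real.1 h
  have hiFF := integrable_mul_refl_mul_weight (L₀ := L₀) ρ hρ JE JM i hFm hFm hFb hFb
  have hiFG := integrable_mul_refl_mul_weight (L₀ := L₀) ρ hρ JE JM i hFm hGm hFb hGb
  have hiGF := integrable_mul_refl_mul_weight (L₀ := L₀) ρ hρ JE JM i hGm hFm hGb hFb
  have hiGG := integrable_mul_refl_mul_weight (L₀ := L₀) ρ hρ JE JM i hGm hGm hGb hGb
  have hexp : ∀ s t : ℝ, ∫ U, (s * F U + t * G' U) * (s * F (σ U) + t * G' (σ U)) * w U ∂μ =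
      s * s * A + s * t * B + s * t * B' + t * t * C := by
    intro s t
    have hpt : (fun U => (s * F U + t * G' U) * (s * F (σ U) + t * G' (σ U)) * w U) =
        fun U => s * s * (F U * F (σ U) * w U) + s * t * (F U * G' (σ U) * w U) +
          s * t * (G' U * F (σ U) * w U) + t * t * (G' U * G' (σ U) * w U) := by
      funext U; ring
    rw [hpt, integral_add, integral_add, integral_add, integral_const_mul, integral_const_mul,
      integral_const_mul, integral_const_mul]
    · exact (hiFF.const_mul _)
    · exact (hiFG.const_mul _)
    · exact (hiFF.const_mul _).add (hiFG.const_mul _)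
    · exact (hiGF.const_mul _)
    · exact ((hiFF.const_mul _).add (hiFG.const_mul _)).add (hiGF.const_mul _)
    · exact (hiGG.const_mul _)
  -- symmetry of the form: `B' = B` (change of variables by the measure-preserving reflection, under which
  -- the weight is invariant)
  have hsymm : B' = B := by
    rw [hB', hB, ← integral_comp_spaceReflect i (fun U => F U * G' (σ U) * w U)]
    refine integral_congr_ae (Eventually.of_forall fun U => ?_)
    simp only [hσ, hw, spaceReflect_spaceReflect, weight_spaceReflect ρ hρu]
    ring
  have hpos : ∀ t : ℝ, 0 ≤ C * (t * t) + (2 * B) * t + A := fun t => by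
    have h := hRP 1 t
    rw [hexp, hsymm] at h
    have e : C * (t * t) + (2 * B) * t + A = 1 * 1 * A + 1 * t * B + 1 * t * B + t * t * C := by ring
    rw [e]; exact h
  have hdisc := discrim_le_zero hpos
  rw [discrim] at hdisc
  nlinarith [hdisc]

end CS

/-! ### §3 The chessboard estimate for functions of the Polyakov loops (TY (2.6) ⟹ (3.9)) -/

section Chessboard

variable {d L₀ : ℕ} [NeZero L₀] {G : Type*} [Group G] {N : ℕ} (ρ : G →* Matrix (Fin N) (Fin N) ℂ)

/-- **Site observables of the twist**: `∏_{x ∈ T} f(Ω[x])` for a function `f` of the Polyakov loop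
(TY's `∏_x f_x(S_x)` with `f_x = f ∘ Ω`, `S_x` the time-like links above `x`). [cite: TomboulisYaffe1985, §II.A eq. (2.6) (p. 315)] -/
def polyakovProd {L : ℕ} (f : G → ℝ) (T : Finset (Fin d → ZMod L)) (U : Config d L₀ L G) : ℝ :=
  ∏ c ∈ T, f (polyakovLine U c)

omit [NeZero L₀] in
/-- Polyakov loops read only the time-like links at their site. [folklore] -/
private theorem polyakovLine_congr' {L : ℕ} {U V : Config d L₀ L G} {y : Fin d → ZMod L}
    (h : ∀ t : ZMod L₀, U ((t, y), none) = V ((t, y), none)) : polyakovLine U y = polyakovLine V y := by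
  have key : ∀ (m : ℕ) (t : ZMod L₀), timeHolonomy U m (t, y) = timeHolonomy V m (t, y) := by
    intro m
    induction m with
    | zero => intro t; rfl
    | succ m ih =>
        intro t
        simp only [timeHolonomy, FiniteTemperature.Site.shift]
        rw [h t, ih]
  exact key L₀ 0

variable {n : ℕ}

/-- The sites of the negative half of the reflection `Θ_{i,k}`, translated back by `(k−1)e_i`, carry
time-like links of the tree's positive block `bondPos` (`(−(c_i − k) − 1).val ≤ n`). [folklore] -/
private theorem val_neg_sub_le (i : Fin d) (k : ZMod (2 * n + 2)) {c : BlockIdx d (2 * n + 2)}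
    (hc : c ∈ halfMinus (2 * n + 2) i k) :
    (-((c + -(Pi.single i (k - 1) : BlockIdx d (2 * n + 2))) i)).val ≤ n := by
  rw [mem_halfMinus] at hc
  have e : -((c + -(Pi.single i (k - 1) : BlockIdx d (2 * n + 2))) i) = -(c i - k) - 1 := by
    simp only [Pi.add_apply, Pi.neg_apply, Pi.single_eq_same]; ring
  rw [e, zmod_val_neg_sub_one]
  have := ZMod.val_lt (c i - k)
  omega

/-- **Admissibility**: a product of site observables over sites whose images under `g` lie in the negative
half of `Θ_{i,k}`, read after the translation by `−(k−1)e_i`, depends only on the positive links of the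
tree's bond reflection. [folklore] -/
private theorem dependsOn_prod_translate (i : Fin d) (k : ZMod (2 * n + 2)) {T : Finset (BlockIdx d (2 * n + 2))}
    (g : BlockIdx d (2 * n + 2) → BlockIdx d (2 * n + 2)) (hg : ∀ c ∈ T, g c ∈ halfMinus (2 * n + 2) i k)
    (f : G → ℝ) :
    DependsOn (fun V : Config d L₀ (2 * n + 2) G =>
        ∏ c ∈ T, f (polyakovLine V (g c + -(Pi.single i (k - 1)))))
      ((bondPos d L₀ n i : Finset _) : Set _) := by
  intro V V' hVV'
  refine Finset.prod_congr rfl fun c hc => ?_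
  have hmem : ∀ t : ZMod L₀,
      (((t, g c + -(Pi.single i (k - 1) : BlockIdx d (2 * n + 2))), none) :
        FiniteTemperature.Site d L₀ (2 * n + 2) × Dir d) ∈ bondPos d L₀ n i := fun t =>
    mem_bondPos.2 ⟨val_neg_sub_le i k (hg c hc), by simp⟩
  rw [polyakovLine_congr' (U := V) (V := V') fun t => hVV' _ (Finset.mem_coe.2 (hmem t))]

variable [TopologicalSpace G] [IsTopologicalGroup G] [CompactSpace G] [MeasurableSpace G] [BorelSpace G]
  [SecondCountableTopology G]

omit [CompactSpace G] in
/-- Site products of a measurable `f` are measurable. [folklore] -/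
private theorem measurable_prod_polyakov {L : ℕ} [NeZero L] {ι : Type*} (s : Finset ι) (g : ι → Fin d → ZMod L)
    {f : G → ℝ} (hfm : Measurable f) :
    Measurable fun U : Config d L₀ L G => ∏ c ∈ s, f (polyakovLine U (g c)) :=
  Finset.measurable_prod _ fun _ _ => hfm.comp (continuous_timeHolonomy L₀ _).measurable

omit [NeZero L₀] [TopologicalSpace G] [IsTopologicalGroup G] [CompactSpace G] [MeasurableSpace G] [BorelSpace G]
  [SecondCountableTopology G] in
/-- Site products of an `f` with values in `[0,1]` take values in `[0,1]`. [folklore] -/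
private theorem prod_polyakov_mem {L : ℕ} {ι : Type*} (s : Finset ι) (g : ι → Fin d → ZMod L)
    {f : G → ℝ} (hf01 : ∀ x, 0 ≤ f x ∧ f x ≤ 1) (U : Config d L₀ L G) :
    0 ≤ ∏ c ∈ s, f (polyakovLine U (g c)) ∧ ∏ c ∈ s, f (polyakovLine U (g c)) ≤ 1 :=
  ⟨Finset.prod_nonneg fun _ _ => (hf01 _).1, Finset.prod_le_one (fun _ _ => (hf01 _).1) fun _ _ => (hf01 _).2⟩

omit [NeZero L₀] [Group G] [TopologicalSpace G] [IsTopologicalGroup G] [CompactSpace G] [BorelSpace G] in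
/-- Translations are measurable. [folklore] -/
private theorem measurable_translate {L : ℕ} (a : Fin d → ZMod L) :
    Measurable (translate (d := d) (L₀ := L₀) (L := L) (G := G) a) := by
  rw [← coe_translateEquiv]; exact (translateEquiv a).measurable

/-- ★ **The chessboard estimate for site functions of the Polyakov loops on the finite-temperature
lattice** (Tomboulis–Yaffe (2.6) "by repeatedly using reflection positivity for timelike planes in
between lattice sites, one may derive the chessboard estimate `⟨∏_x f_x(S_x)⟩ ≤ ∏_y ⟨∏_x f_y(S_x)⟩^{1/|Λ_s|}`",
for one `f`; Fröhlich–Israel–Lieb–Simon Thm. 4.1): for a compact group, a continuous unitary `ρ`,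
`J_E, J_M ≥ 0`, an even spatial side `L_s = 2n + 2`, and a measurable `f : G → [0,1]` with
`⟨∏_x f(Ω[x])⟩ > 0`: `⟨∏_{x∈T} f(Ω[x])⟩ ≤ ⟨∏_{x} f(Ω[x])⟩^{|T|/L_s^d}` — the tree's abstract chessboard
estimate `chessboard_le_rpow_even` fed with the reflection Cauchy–Schwarz inequalities of §2, transported to
all bond planes by translation. [cite: TomboulisYaffe1985, §II.A eq. (2.6) (p. 315)] [cite: FrohlichIsraelLiebSimon1978, Thm. 4.1] [cite: FriedliVelenik2017, Thm. 10.11] -/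
theorem expectation_polyakovProd_le_rpow (hρu : ∀ g, ρ g ∈ Matrix.unitaryGroup (Fin N) ℂ) (hρ : Continuous ρ)
    {JE JM : ℝ} (hJE : 0 ≤ JE) (hJM : 0 ≤ JM) {f : G → ℝ} (hfm : Measurable f) (hf01 : ∀ x, 0 ≤ f x ∧ f x ≤ 1)
    (hpos : 0 < expectation ρ JE JM (polyakovProd (d := d) (L₀ := L₀) f (Finset.univ : Finset (Fin d → ZMod (2 * n + 2)))))
    (T : Finset (Fin d → ZMod (2 * n + 2))) :
    expectation ρ JE JM (polyakovProd (d := d) (L₀ := L₀) f T) ≤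
      expectation ρ JE JM (polyakovProd (d := d) (L₀ := L₀) f (Finset.univ : Finset (BlockIdx d (2 * n + 2)))) ^
        ((T.card : ℝ) / ((2 * n + 2 : ℕ) : ℝ) ^ d) := by
  classical
  have hN : Even (2 * n + 2) := ⟨n + 1, by ring⟩
  have hZ := partitionFunction_pos (d := d) (L₀ := L₀) (L := 2 * n + 2) ρ hρ JE JM
  set ψ : Finset (BlockIdx d (2 * n + 2)) → ℝ := fun S =>
    expectation ρ JE JM (polyakovProd (d := d) (L₀ := L₀) f S) with hψ
  -- nonnegativity, normalisation
  have h0 : ∀ S, 0 ≤ ψ S := fun S => by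
    simp only [hψ, expectation]
    exact div_nonneg (integral_nonneg fun U => mul_nonneg (prod_polyakov_mem S id hf01 U).1
      (weight_pos ρ JE JM U).le) hZ.le
  have hempty : ψ ∅ ≤ 1 := by
    have he : polyakovProd (L₀ := L₀) f (∅ : Finset (BlockIdx d (2 * n + 2))) =
        fun _ : Config d L₀ (2 * n + 2) G => (1 : ℝ) := by
      funext U; simp [polyakovProd]
    show expectation ρ JE JM (polyakovProd (L₀ := L₀) f (∅ : Finset (BlockIdx d (2 * n + 2)))) ≤ 1
    rw [he, expectation_const ρ hZ]
  have h1 : 0 < ψ Finset.univ := hpos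
  -- the reflection Cauchy–Schwarz inequalities
  have hcs : ∀ (i : Fin d) (k : ZMod (2 * n + 2)) (S : Finset (BlockIdx d (2 * n + 2))),
      ψ S ^ 2 ≤ ψ (symP i k S) * ψ (symM i k S) := by
    intro i k S
    set θk := cellReflect i k with hθk
    set a : Fin d → ZMod (2 * n + 2) := Pi.single i (k - 1) with ha
    set Sp := S ∩ halfPlus (2 * n + 2) i k with hSp
    set Sm := S ∩ halfMinus (2 * n + 2) i k with hSm
    -- the two half observables and their translates
    set F : Config d L₀ (2 * n + 2) G → ℝ := fun U => ∏ c ∈ Sm, f (polyakovLine U c) with hF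
    set Gf : Config d L₀ (2 * n + 2) G → ℝ := fun U => ∏ c ∈ Sp, f (polyakovLine U (θk c)) with hGf
    -- the three products
    have hSsplit : S = Sm ∪ Sp := by
      ext c; simp only [hSp, hSm, Finset.mem_union, Finset.mem_inter]
      constructor
      · intro hc
        rcases mem_halfPlus_or_mem_halfMinus i k c with h | h
        · exact Or.inr ⟨hc, h⟩
        · exact Or.inl ⟨hc, h⟩
      · rintro (⟨hc, -⟩ | ⟨hc, -⟩) <;> exact hc
    have hSdisj : Disjoint Sm Sp := by
      rw [hSm, hSp, Finset.disjoint_left]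
      intro c hc hc'
      exact Finset.disjoint_left.1 (disjoint_halfPlus_halfMinus i k) (Finset.mem_inter.1 hc').2
        (Finset.mem_inter.1 hc).2
    have hPdisj : Disjoint Sp (Sp.image θk) := by
      rw [Finset.disjoint_left]
      intro c hc hc'
      obtain ⟨c', hc', hcc'⟩ := Finset.mem_image.1 hc'
      have h1 : c ∈ halfPlus (2 * n + 2) i k := (Finset.mem_inter.1 hc).2
      have h2 : c ∈ halfMinus (2 * n + 2) i k := hcc' ▸ cellReflect_mem_halfMinus hN (Finset.mem_inter.1 hc').2
      exact Finset.disjoint_left.1 (disjoint_halfPlus_halfMinus i k) h1 h2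
    have hMdisj : Disjoint Sm (Sm.image θk) := by
      rw [Finset.disjoint_left]
      intro c hc hc'
      obtain ⟨c', hc', hcc'⟩ := Finset.mem_image.1 hc'
      have h1 : c ∈ halfMinus (2 * n + 2) i k := (Finset.mem_inter.1 hc).2
      have h2 : c ∈ halfPlus (2 * n + 2) i k := hcc' ▸ cellReflect_mem_halfPlus hN (Finset.mem_inter.1 hc').2
      exact Finset.disjoint_left.1 (disjoint_halfPlus_halfMinus i k) h2 h1
    have hθinj : ∀ (R : Finset (BlockIdx d (2 * n + 2))), Set.InjOn θk R := fun R c _ c' _ h => θk.injective h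
    have e1 : ∀ U, polyakovProd (L₀ := L₀) f S U = F U * Gf (reflAt i k U) := fun U => by
      simp only [polyakovProd, hF, hGf, polyakovLine_reflAt, hθk, cellReflect_cellReflect]
      rw [hSsplit, Finset.prod_union hSdisj]
    have e2 : ∀ U, polyakovProd (L₀ := L₀) f (symM i k S) U = F U * F (reflAt i k U) := fun U => by
      simp only [polyakovProd, hF, polyakovLine_reflAt]
      rw [symM, ← hSm, Finset.prod_union hMdisj, Finset.prod_image (hθinj Sm)]
    have e3 : ∀ U, polyakovProd (L₀ := L₀) f (symP i k S) U = Gf U * Gf (reflAt i k U) := fun U => by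
      simp only [polyakovProd, hGf, polyakovLine_reflAt, hθk, cellReflect_cellReflect]
      rw [symP, ← hSp, Finset.prod_union hPdisj, Finset.prod_image (hθinj Sp), mul_comm]
    -- the translated observables are admissible for the base reflection
    set τ : Config d L₀ (2 * n + 2) G → Config d L₀ (2 * n + 2) G := translate (-a) with hτ
    have hFτ : ∀ V, F (τ V) = ∏ c ∈ Sm, f (polyakovLine V (id c + -a)) := fun V => by
      simp only [hF, hτ, polyakovLine_translate, id]
    have hGτ : ∀ V, Gf (τ V) = ∏ c ∈ Sp, f (polyakovLine V (θk c + -a)) := fun V => by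
      simp only [hGf, hτ, polyakovLine_translate]
    have hFd : DependsOn (fun V => F (τ V)) ((bondPos d L₀ n i : Finset _) : Set _) := by
      simp_rw [hFτ]
      exact dependsOn_prod_translate i k id (fun c hc => (Finset.mem_inter.1 hc).2) f
    have hGd : DependsOn (fun V => Gf (τ V)) ((bondPos d L₀ n i : Finset _) : Set _) := by
      simp_rw [hGτ]
      exact dependsOn_prod_translate i k θk (fun c hc => cellReflect_mem_halfMinus hN (Finset.mem_inter.1 hc).2) f
    have hτm : Measurable τ := measurable_translate (-a)
    have hFm : Measurable fun V => F (τ V) := (measurable_prod_polyakov Sm id hfm).comp hτm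
    have hGm : Measurable fun V => Gf (τ V) := (measurable_prod_polyakov Sp θk hfm).comp hτm
    have hFb : ∀ V, |F (τ V)| ≤ 1 := fun V =>
      have h := prod_polyakov_mem (L₀ := L₀) Sm id hf01 (τ V)
      abs_le.2 ⟨(neg_nonpos.2 zero_le_one).trans h.1, h.2⟩
    have hGb : ∀ V, |Gf (τ V)| ≤ 1 := fun V =>
      have h := prod_polyakov_mem (L₀ := L₀) Sp θk hf01 (τ V)
      abs_le.2 ⟨(neg_nonpos.2 zero_le_one).trans h.1, h.2⟩
    -- Cauchy–Schwarz at the base planes, and the change of variables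
    have key := sq_integral_mul_spaceReflect_le (L₀ := L₀) ρ hρu hρ hJE hJM i hFm hGm hFb hGb hFd hGd
    have iS : ∫ U, polyakovProd (L₀ := L₀) f S U * weight ρ JE JM U ∂haar d L₀ (2 * n + 2) G =
        ∫ V, F (τ V) * Gf (τ (spaceReflect i V)) * weight ρ JE JM V ∂haar d L₀ (2 * n + 2) G := by
      simp_rw [e1]; exact integral_reflAt ρ JE JM i k F Gf
    have iM : ∫ U, polyakovProd (L₀ := L₀) f (symM i k S) U * weight ρ JE JM U ∂haar d L₀ (2 * n + 2) G =
        ∫ V, F (τ V) * F (τ (spaceReflect i V)) * weight ρ JE JM V ∂haar d L₀ (2 * n + 2) G := by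
      simp_rw [e2]; exact integral_reflAt ρ JE JM i k F F
    have iP : ∫ U, polyakovProd (L₀ := L₀) f (symP i k S) U * weight ρ JE JM U ∂haar d L₀ (2 * n + 2) G =
        ∫ V, Gf (τ V) * Gf (τ (spaceReflect i V)) * weight ρ JE JM V ∂haar d L₀ (2 * n + 2) G := by
      simp_rw [e3]; exact integral_reflAt ρ JE JM i k Gf Gf
    simp only [hψ, expectation]
    rw [iS, iM, iP, div_pow, div_mul_div_comm, ← sq]
    exact div_le_div_of_nonneg_right (key.trans_eq (mul_comm _ _)) (sq_nonneg _)
  have h := chessboard_le_rpow_even hN h0 hempty h1 hcs T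
  simpa [hψ] using h

/-- ★ **TY (3.9): one site against the thermodynamic product** — `⟨f(Ω[x])⟩ ≤ ⟨∏_y f(Ω[y])⟩^{1/L_s^d}`
("We begin by using the chessboard estimates (2.6) and (2.7) to bound these local expectations by
thermodynamic quantities"). [cite: TomboulisYaffe1985, §III.C eq. (3.9) (p. 323); §II.A eq. (2.6) (p. 315)] -/
theorem expectation_polyakov_le_rpow (hρu : ∀ g, ρ g ∈ Matrix.unitaryGroup (Fin N) ℂ) (hρ : Continuous ρ)
    {JE JM : ℝ} (hJE : 0 ≤ JE) (hJM : 0 ≤ JM) {f : G → ℝ} (hfm : Measurable f) (hf01 : ∀ x, 0 ≤ f x ∧ f x ≤ 1)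
    (hpos : 0 < expectation ρ JE JM (polyakovProd (d := d) (L₀ := L₀) f (Finset.univ : Finset (Fin d → ZMod (2 * n + 2)))))
    (x : Fin d → ZMod (2 * n + 2)) :
    expectation ρ JE JM (fun U : Config d L₀ (2 * n + 2) G => f (polyakovLine U x)) ≤
      expectation ρ JE JM (polyakovProd (d := d) (L₀ := L₀) f (Finset.univ : Finset (BlockIdx d (2 * n + 2)))) ^ ((1 : ℝ) / ((2 * n + 2 : ℕ) : ℝ) ^ d) := by
  have h := expectation_polyakovProd_le_rpow (L₀ := L₀) ρ hρu hρ hJE hJM hfm hf01 hpos {x}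
  have he : polyakovProd (L₀ := L₀) f ({x} : Finset (BlockIdx d (2 * n + 2))) =
      fun U : Config d L₀ (2 * n + 2) G => f (polyakovLine U x) := by
    funext U; simp [polyakovProd]
  rw [he] at h
  simpa using h

end Chessboard

/-! ### §4 (appended) The site reflections `Σ_{i,k}` in the lattice planes `x_i = k`, `x_i = k + L/2` and their
Cauchy–Schwarz inequality

Tomboulis–Yaffe's bond chessboard (2.7) uses "reflections in timelike planes through lattice sites plus timelike
dihedral planes" (p. 316). The site planes are in the tree (`spaceSiteReflect`, reflection positivity
`integral_mul_conj_spaceSiteReflect_mul_weight_nonneg`, Borgs–Seiler §II.2: "reflection positivity with respect to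
reflection both in lattice planes and in planes lying half-way between lattice planes"); this section is the
site-plane twin of §§1–2: invariance of the weight, the conjugated reflections in ALL lattice planes, the change of
variables, and the Cauchy–Schwarz inequality of the Osterwalder–Schrader form. -/

section SiteReflection

variable {d L₀ L : ℕ} [NeZero L₀] [NeZero L] {G : Type*} [Group G] {N : ℕ}
  (ρ : G →* Matrix (Fin N) (Fin N) ℂ)

/-- **The Wilson weight is invariant under the spatial site reflection** `σ = τ_{e_i} ∘ θ` (unitary `ρ`).
[cite: BorgsSeiler1983, §II.2 (pp. 331–332)] -/
theorem weight_spaceSiteReflect (hρu : ∀ g, ρ g ∈ Matrix.unitaryGroup (Fin N) ℂ) (JE JM : ℝ) (i : Fin d)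
    (U : Config d L₀ L G) : weight ρ JE JM (spaceSiteReflect i U) = weight ρ JE JM U := by
  rw [spaceSiteReflect, weight_translate, weight_spaceReflect ρ hρu]

omit [NeZero L₀] [NeZero L] in
/-- Polyakov loops under the site reflection: `Ω[c](σU) = Ω[σc](U)`, `σc = c[i ↦ −c_i]`. [cite: BorgsSeiler1983, §II.2 (pp. 331–332)] -/
theorem polyakovLine_spaceSiteReflect (i : Fin d) (U : Config d L₀ L G) (c : Fin d → ZMod L) :
    polyakovLine (spaceSiteReflect i U) c = polyakovLine U (siteRefl i c) := by
  rw [spaceSiteReflect, polyakovLine_translate, polyakovLine_spaceReflect, bondRefl_add_single]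

omit [NeZero L₀] [NeZero L] in
/-- **Polyakov loops under the conjugated site reflection** `Σ_{i,k} = τ_{−k e_i} ∘ σ ∘ τ_{k e_i}` (the reflection in the
lattice planes `x_i = k`, `x_i = k + L/2`): `Ω[c](Σ_{i,k} U) = Ω[c[i ↦ 2k − c_i]](U)`. [cite: FriedliVelenik2017, §10.3 (reflections through vertices)] -/
theorem polyakovLine_siteReflAt (i : Fin d) (k : ZMod L) (U : Config d L₀ L G) (c : Fin d → ZMod L) :
    polyakovLine (translate (-(Pi.single i k)) (spaceSiteReflect i (translate (Pi.single i k) U))) c =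
      polyakovLine U (Function.update c i (2 * k - c i)) := by
  rw [polyakovLine_translate, polyakovLine_spaceSiteReflect, polyakovLine_translate]
  congr 1
  funext j
  by_cases hj : j = i
  · subst hj
    simp only [Pi.add_apply, siteRefl_apply_same, Pi.neg_apply, Pi.single_eq_same, Function.update_self]
    ring
  · simp only [Pi.add_apply, siteRefl_apply_of_ne hj, Pi.neg_apply, Pi.single_eq_of_ne hj,
      Function.update_of_ne hj, neg_zero, add_zero]

omit [NeZero L₀] [NeZero L] in
/-- `Σ_{i,k}` after the inverse translation: `Σ_{i,k}(τ_{−a} V) = τ_{−a}(σ V)`, `a = k e_i`. [folklore] -/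
private theorem siteReflAt_translate_neg (i : Fin d) (k : ZMod L) (V : Config d L₀ L G) :
    translate (-(Pi.single i k)) (spaceSiteReflect i (translate (Pi.single i k) (translate (-(Pi.single i k)) V))) =
      translate (-(Pi.single i k)) (spaceSiteReflect i V) := by
  rw [translate_translate, add_neg_cancel, translate_zero]

omit [NeZero L₀] [NeZero L] in
/-- The site reflection is an involution (`σ = τ_{e_i} θ`, `θ τ_{e_i} = τ_{−e_i} θ`, `θ² = 1`). [cite: BorgsSeiler1983, §II.2 (pp. 331–332)] -/
theorem spaceSiteReflect_spaceSiteReflect (i : Fin d) (U : Config d L₀ L G) :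
    spaceSiteReflect i (spaceSiteReflect i U) = U := by
  rw [spaceSiteReflect, spaceSiteReflect, spaceReflect_translate, spaceReflect_spaceReflect, translate_translate,
    ← Pi.single_add, add_neg_cancel, Pi.single_zero, translate_zero]

variable [TopologicalSpace G] [IsTopologicalGroup G] [CompactSpace G] [MeasurableSpace G] [BorelSpace G]
  [SecondCountableTopology G]

omit [SecondCountableTopology G] in
/-- **Change of variables for the conjugated site reflection**:
`∫ X(U) Y(Σ_{i,k}U) e^{−S(U)} = ∫ X(τ_{−a}V) Y(τ_{−a}σV) e^{−S(V)}`, `a = k e_i`. [cite: FriedliVelenik2017, §10.4.1 (proof of Thm. 10.11)] -/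
private theorem integral_siteReflAt (JE JM : ℝ) (i : Fin d) (k : ZMod L) (X Y : Config d L₀ L G → ℝ) :
    ∫ U, X U * Y (translate (-(Pi.single i k)) (spaceSiteReflect i (translate (Pi.single i k) U))) * weight ρ JE JM U
        ∂haar d L₀ L G =
      ∫ V, X (translate (-(Pi.single i k)) V) *
        Y (translate (-(Pi.single i k)) (spaceSiteReflect i V)) * weight ρ JE JM V ∂haar d L₀ L G := by
  have hmp := measurePreserving_translateEquiv (d := d) (L₀ := L₀) (L := L) (G := G) (-(Pi.single i k))
  have h := hmp.integral_comp' (fun U : Config d L₀ L G =>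
    X U * Y (translate (-(Pi.single i k)) (spaceSiteReflect i (translate (Pi.single i k) U))) * weight ρ JE JM U)
  rw [coe_translateEquiv] at h
  rw [← h]
  refine integral_congr_ae (Eventually.of_forall fun V => ?_)
  simp only [siteReflAt_translate_neg, weight_translate]

/-- Change of variables by the site reflection (`σ = τ_{e_i} ∘ θ`, both measure preserving). [folklore] -/
private theorem integral_comp_spaceSiteReflect (i : Fin d) (f : Config d L₀ L G → ℝ) :
    ∫ U, f (spaceSiteReflect i U) ∂haar d L₀ L G = ∫ U, f U ∂haar d L₀ L G := by
  have h1 := integral_comp_spaceReflect (L₀ := L₀) (L := L) (G := G) i (fun U => f (translate (Pi.single i 1) U))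
  have hmp := measurePreserving_translateEquiv (d := d) (L₀ := L₀) (L := L) (G := G) (Pi.single i 1)
  have h2 := hmp.integral_comp' f
  rw [coe_translateEquiv] at h2
  simp only [spaceSiteReflect]
  rw [h1, h2]

end SiteReflection

section SiteCS

variable {d L₀ n : ℕ} [NeZero L₀] {G : Type*} [Group G] [TopologicalSpace G] [IsTopologicalGroup G]
  [CompactSpace G] [MeasurableSpace G] [BorelSpace G] [SecondCountableTopology G] {N : ℕ}
  (ρ : G →* Matrix (Fin N) (Fin N) ℂ)

/-- Products against a site-reflected observable are integrable against the weight. [folklore] -/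
private theorem integrable_mul_siteRefl_mul_weight (hρ : Continuous ρ) (JE JM : ℝ) (i : Fin d)
    {F G' : Config d L₀ (2 * n + 2) G → ℝ} (hFm : Measurable F) (hGm : Measurable G') {KF KG : ℝ}
    (hFb : ∀ U, |F U| ≤ KF) (hGb : ∀ U, |G' U| ≤ KG) :
    Integrable (fun U => F U * G' (spaceSiteReflect i U) * weight ρ JE JM U) (haar d L₀ (2 * n + 2) G) := by
  refine integrable_mul_weight ρ hρ JE JM
    ((hFm.mul (hGm.comp (continuous_spaceSiteReflect i).measurable)).aestronglyMeasurable) (C := KF * KG) fun U => ?_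
  rw [abs_mul]
  exact mul_le_mul (hFb U) (hGb _) (abs_nonneg _) ((abs_nonneg _).trans (hFb U))

/-- **Cauchy–Schwarz of the Osterwalder–Schrader form in the spatial LATTICE planes** `x_i = 0`, `x_i = L/2`
(`L = 2n + 2`, `n ≥ 1`; TY (2.5) for "planes … which contain lattice sites"): from the tree's positivity
`integral_mul_conj_spaceSiteReflect_mul_weight_nonneg` on `F + tG`, the symmetry of the form (the site reflection
preserves `∏dg` and the weight) and the discriminant,
`(∫ F·(G∘σ) e^{−S})² ≤ (∫ F·(F∘σ) e^{−S}) (∫ G·(G∘σ) e^{−S})` for real bounded measurable `F, G` depending on the links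
of the closed half `{−L/2 ≤ x_i ≤ 0}` (`sitePos ∪ siteShared`); every real `J_E, J_M`. [cite: TomboulisYaffe1985, §II.A eqs. (2.4)–(2.5) (p. 315)] [cite: BorgsSeiler1983, §II.2 (pp. 331–332)] -/
theorem sq_integral_mul_spaceSiteReflect_le (hρu : ∀ g, ρ g ∈ Matrix.unitaryGroup (Fin N) ℂ) (hρ : Continuous ρ)
    (hn : 1 ≤ n) (JE JM : ℝ) (i : Fin d) {F G' : Config d L₀ (2 * n + 2) G → ℝ}
    (hFm : Measurable F) (hGm : Measurable G') {KF KG : ℝ} (hFb : ∀ U, |F U| ≤ KF) (hGb : ∀ U, |G' U| ≤ KG)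
    (hFd : DependsOn F ((sitePos d L₀ n i ∪ ∅ ∪ siteShared d L₀ n i : Finset _) : Set _))
    (hGd : DependsOn G' ((sitePos d L₀ n i ∪ ∅ ∪ siteShared d L₀ n i : Finset _) : Set _)) :
    (∫ U, F U * G' (spaceSiteReflect i U) * weight ρ JE JM U ∂haar d L₀ (2 * n + 2) G) ^ 2 ≤
      (∫ U, F U * F (spaceSiteReflect i U) * weight ρ JE JM U ∂haar d L₀ (2 * n + 2) G) *
        (∫ U, G' U * G' (spaceSiteReflect i U) * weight ρ JE JM U ∂haar d L₀ (2 * n + 2) G) := by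
  set μ := haar d L₀ (2 * n + 2) G with hμ
  set w : Config d L₀ (2 * n + 2) G → ℝ := fun U => weight ρ JE JM U with hw
  set σ : Config d L₀ (2 * n + 2) G → Config d L₀ (2 * n + 2) G := spaceSiteReflect i with hσ
  set A : ℝ := ∫ U, F U * F (σ U) * w U ∂μ with hA
  set B : ℝ := ∫ U, F U * G' (σ U) * w U ∂μ with hB
  set B' : ℝ := ∫ U, G' U * F (σ U) * w U ∂μ with hB'
  set C : ℝ := ∫ U, G' U * G' (σ U) * w U ∂μ with hC
  -- reflection positivity of the real combinations `s F + t G`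
  have hRP : ∀ s t : ℝ, 0 ≤ ∫ U, (s * F U + t * G' U) * (s * F (σ U) + t * G' (σ U)) * w U ∂μ := by
    intro s t
    set O : Config d L₀ (2 * n + 2) G → ℂ := fun U => ((s * F U + t * G' U : ℝ) : ℂ) with hO
    have hOm : Measurable O :=
      Complex.measurable_ofReal.comp ((measurable_const.mul hFm).add (measurable_const.mul hGm))
    have hOb : ∀ U, ‖O U‖ ≤ |s| * KF + |t| * KG := fun U => by
      rw [hO, Complex.norm_real, Real.norm_eq_abs]
      calc |s * F U + t * G' U| ≤ |s * F U| + |t * G' U| := abs_add_le _ _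
        _ = |s| * |F U| + |t| * |G' U| := by rw [abs_mul, abs_mul]
        _ ≤ |s| * KF + |t| * KG := add_le_add (mul_le_mul_of_nonneg_left (hFb U) (abs_nonneg s))
            (mul_le_mul_of_nonneg_left (hGb U) (abs_nonneg t))
    have hOd : DependsOn O ((sitePos d L₀ n i ∪ ∅ ∪ siteShared d L₀ n i : Finset _) : Set _) :=
      fun U V hUV => by simp only [hO, hFd hUV, hGd hUV]
    have h := integral_mul_conj_spaceSiteReflect_mul_weight_nonneg ρ hρu hρ hn JE JM i hOm hOb hOd
    have hint : (fun U => O U * conj (O (spaceSiteReflect i U)) * (weight ρ JE JM U : ℂ)) =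
        fun U => (((s * F U + t * G' U) * (s * F (σ U) + t * G' (σ U)) * w U : ℝ) : ℂ) := by
      funext U; simp only [hO, hσ, hw, Complex.conj_ofReal]; push_cast; ring
    rw [hint, integral_complex_ofReal] at h
    exact Complex.zero_le_real.1 h
  have hiFF := integrable_mul_siteRefl_mul_weight (L₀ := L₀) ρ hρ JE JM i hFm hFm hFb hFb
  have hiFG := integrable_mul_siteRefl_mul_weight (L₀ := L₀) ρ hρ JE JM i hFm hGm hFb hGb
  have hiGF := integrable_mul_siteRefl_mul_weight (L₀ := L₀) ρ hρ JE JM i hGm hFm hGb hFb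
  have hiGG := integrable_mul_siteRefl_mul_weight (L₀ := L₀) ρ hρ JE JM i hGm hGm hGb hGb
  have hexp : ∀ s t : ℝ, ∫ U, (s * F U + t * G' U) * (s * F (σ U) + t * G' (σ U)) * w U ∂μ =
      s * s * A + s * t * B + s * t * B' + t * t * C := by
    intro s t
    have hpt : (fun U => (s * F U + t * G' U) * (s * F (σ U) + t * G' (σ U)) * w U) =
        fun U => s * s * (F U * F (σ U) * w U) + s * t * (F U * G' (σ U) * w U) +
          s * t * (G' U * F (σ U) * w U) + t * t * (G' U * G' (σ U) * w U) := by
      funext U; ring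
    rw [hpt, integral_add, integral_add, integral_add, integral_const_mul, integral_const_mul,
      integral_const_mul, integral_const_mul]
    · exact (hiFF.const_mul _)
    · exact (hiFG.const_mul _)
    · exact (hiFF.const_mul _).add (hiFG.const_mul _)
    · exact (hiGF.const_mul _)
    · exact ((hiFF.const_mul _).add (hiFG.const_mul _)).add (hiGF.const_mul _)
    · exact (hiGG.const_mul _)
  -- symmetry of the form: `B' = B`
  have hsymm : B' = B := by
    rw [hB', hB, ← integral_comp_spaceSiteReflect i (fun U => F U * G' (σ U) * w U)]
    refine integral_congr_ae (Eventually.of_forall fun U => ?_)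
    simp only [hσ, hw, spaceSiteReflect_spaceSiteReflect, weight_spaceSiteReflect ρ hρu]
    ring
  have hpos : ∀ t : ℝ, 0 ≤ C * (t * t) + (2 * B) * t + A := fun t => by
    have h := hRP 1 t
    rw [hexp, hsymm] at h
    have e : C * (t * t) + (2 * B) * t + A = 1 * 1 * A + 1 * t * B + 1 * t * B + t * t * C := by ring
    rw [e]; exact h
  have hdisc := discrim_le_zero hpos
  rw [discrim] at hdisc
  nlinarith [hdisc]

end SiteCS

/-! ### §5 (appended) The chessboard estimate for BOND functions of the Polyakov loops (TY (2.7) ⟹ (3.10)),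
without dihedral planes

For a fixed lattice direction `i`, the nearest-neighbour bonds `⟨c, c + e_i⟩` are indexed by their base points
`c ∈ (ℤ/L)^d`, and a symmetric bond function `f(Ω[c], Ω[c + e_i])` is a function of the time-like links above the
closed unit segment `[c, c + e_i]`. These segments are the cells of the arrangement made of the LATTICE planes
`x_i = k` (all `k`) and the BOND planes `x_j = k − ½` (`j ≠ i`, all `k`): both families act on the cell index `c` by
the same formula `c ↦ c[· ↦ 2k − 1 − c_·]` (the tree's `cellReflect`), a site reflection `x_i ↦ 2k − x_i` mapping
the segment `[c_i, c_i + 1]` to `[2k − 1 − c_i, 2k − c_i]` (with its orientation reversed — whence the symmetry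
assumption on `f`) and a bond reflection `x_j ↦ 2k − 1 − x_j` translating it. Hence the abstract chessboard estimate
`chessboard_le_rpow_even` applies VERBATIM, fed with the site-plane Cauchy–Schwarz inequality of §4 in the
direction `i` and the bond-plane one of §2 in the directions `j ≠ i` — no dihedral plane is needed. The price is
the shape of the majorant: instead of TY's checkerboard pattern `∏_{x even} P⁺_x ∏_{y odd} P⁻_y` of (3.10) one gets
the pattern staggered along the axis `i` only, `⟨∏_{c} f(Ω[c], Ω[c+e_i])⟩^{|T|/L^d}`, which serves the Peierls bound
(3.6)/(3.26) equally well (§6). -/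

section BondChessboard

variable {d L₀ : ℕ} [NeZero L₀] {G : Type*} [Group G] {N : ℕ} (ρ : G →* Matrix (Fin N) (Fin N) ℂ)

variable {n : ℕ}

/-- Transverse bond reflections translate direction-`i` segments: `θ_{j,k}(c + e_i) = θ_{j,k} c + e_i` for `j ≠ i`.
[cite: FriedliVelenik2017, §10.2] -/
private theorem cellReflect_add_single_of_ne {L : ℕ} {i j : Fin d} (hji : j ≠ i) (k : ZMod L) (c : BlockIdx d L) :
    cellReflect j k (c + Pi.single i 1) = cellReflect j k c + Pi.single i 1 := by
  funext l
  by_cases hl : l = j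
  · subst hl
    simp only [cellReflect_apply, Function.update_self, Pi.add_apply, Pi.single_eq_of_ne hji, add_zero]
  · simp only [cellReflect_apply, Function.update_of_ne hl, Pi.add_apply]

/-- The site reflection `x_i ↦ 2k − x_i` maps the far end of the reflected segment to the far end of the segment:
`σ_k(θ_{i,k} c) = c + e_i`. [cite: FriedliVelenik2017, §10.2] -/
private theorem update_cellReflect_eq_add {L : ℕ} (i : Fin d) (k : ZMod L) (c : BlockIdx d L) :
    Function.update (cellReflect i k c) i (2 * k - cellReflect i k c i) = c + Pi.single i 1 := by
  funext l
  by_cases hl : l = i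
  · subst hl
    simp only [cellReflect_apply, Function.update_self, Pi.add_apply, Pi.single_eq_same]
    ring
  · simp only [cellReflect_apply, Function.update_of_ne hl, Pi.add_apply, Pi.single_eq_of_ne hl, add_zero]

/-- … and the near end of the reflected segment's far end back to the base point: `σ_k(θ_{i,k} c + e_i) = c`.
[cite: FriedliVelenik2017, §10.2] -/
private theorem update_cellReflect_add_eq {L : ℕ} (i : Fin d) (k : ZMod L) (c : BlockIdx d L) :
    Function.update (cellReflect i k c + Pi.single i 1) i
        (2 * k - (cellReflect i k c + Pi.single i 1 : BlockIdx d L) i) = c := by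
  funext l
  by_cases hl : l = i
  · subst hl
    simp only [cellReflect_apply, Function.update_self, Pi.add_apply, Pi.single_eq_same]
    ring
  · simp only [cellReflect_apply, Function.update_of_ne hl, Pi.add_apply, Pi.single_eq_of_ne hl, add_zero]

/-- `σ_k c = θ_{i,k} c + e_i`. [cite: FriedliVelenik2017, §10.2] -/
private theorem update_eq_cellReflect_add {L : ℕ} (i : Fin d) (k : ZMod L) (c : BlockIdx d L) :
    Function.update c i (2 * k - c i) = cellReflect i k c + Pi.single i 1 := by
  funext l
  by_cases hl : l = i
  · subst hl
    simp only [cellReflect_apply, Function.update_self, Pi.add_apply, Pi.single_eq_same]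
    ring
  · simp only [cellReflect_apply, Function.update_of_ne hl, Pi.add_apply, Pi.single_eq_of_ne hl, add_zero]

/-- `σ_k (c + e_i) = θ_{i,k} c`. [cite: FriedliVelenik2017, §10.2] -/
private theorem update_add_eq_cellReflect {L : ℕ} (i : Fin d) (k : ZMod L) (c : BlockIdx d L) :
    Function.update (c + Pi.single i 1) i (2 * k - (c + Pi.single i 1 : BlockIdx d L) i) = cellReflect i k c := by
  funext l
  by_cases hl : l = i
  · subst hl
    simp only [cellReflect_apply, Function.update_self, Pi.add_apply, Pi.single_eq_same]
    ring
  · simp only [cellReflect_apply, Function.update_of_ne hl, Pi.add_apply, Pi.single_eq_of_ne hl, add_zero]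

/-- Membership in a half of a transverse reflection depends on the transverse coordinate only. [folklore] -/
private theorem add_single_mem_halfMinus_of_ne {i j : Fin d} (hji : j ≠ i) {k : ZMod (2 * n + 2)}
    {c : BlockIdx d (2 * n + 2)} (hc : c ∈ halfMinus (2 * n + 2) j k) : c + Pi.single i 1 ∈ halfMinus (2 * n + 2) j k := by
  rw [mem_halfMinus] at hc ⊢
  simpa [Pi.add_apply, Pi.single_eq_of_ne hji] using hc

/-- Time-like links at the sites of the closed half `{x_i ∈ {0, −1, …, −(n+1)}}` are admissible for the site
reflection (`sitePos ∪ siteShared`). [folklore] -/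
private theorem timelike_mem_siteHalf (i : Fin d) {y : Fin d → ZMod (2 * n + 2)} (hy : (-y i).val ≤ n + 1)
    (t : ZMod L₀) :
    (((t, y), none) : FiniteTemperature.Site d L₀ (2 * n + 2) × Dir d) ∈
      (sitePos d L₀ n i ∪ ∅ ∪ siteShared d L₀ n i : Finset _) := by
  simp only [Finset.union_empty, Finset.mem_union, mem_sitePos, mem_siteShared]
  by_cases h0 : (-y i).val = 0
  · right
    refine ⟨by simp, Or.inl ?_⟩
    rw [ZMod.val_eq_zero, neg_eq_zero] at h0
    exact h0
  by_cases hn1 : (-y i).val = n + 1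
  · right
    refine ⟨by simp, Or.inr ?_⟩
    have h : -y i = ((n + 1 : ℕ) : ZMod (2 * n + 2)) := by
      apply ZMod.val_injective
      rw [hn1, val_natCast_half]
    have h' : y i = -((n + 1 : ℕ) : ZMod (2 * n + 2)) := by rw [← h, neg_neg]
    rw [h', neg_half]
  · left; left
    exact ⟨by omega, by omega⟩

/-- For a cell in the negative half of `Σ_{i,k}`, both ends of the segment, translated back by `k e_i`, lie in the
closed half of the base site reflection. [folklore] -/
private theorem val_neg_ends_le (i : Fin d) (k : ZMod (2 * n + 2)) {c : BlockIdx d (2 * n + 2)}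
    (hc : c ∈ halfMinus (2 * n + 2) i k) :
    (-((c + -(Pi.single i k : BlockIdx d (2 * n + 2)) : BlockIdx d (2 * n + 2)) i)).val ≤ n + 1 ∧
      (-((c + Pi.single i 1 + -(Pi.single i k : BlockIdx d (2 * n + 2)) : BlockIdx d (2 * n + 2)) i)).val ≤
        n + 1 := by
  rw [mem_halfMinus] at hc
  have hlt := ZMod.val_lt (c i - k)
  constructor
  · have e : -((c + -(Pi.single i k : BlockIdx d (2 * n + 2)) : BlockIdx d (2 * n + 2)) i) = -(c i - k) := by
      simp only [Pi.add_apply, Pi.neg_apply, Pi.single_eq_same]; ring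
    rw [e, ZMod.neg_val]
    split_ifs with h
    · simp
    · omega
  · have e : -((c + Pi.single i 1 + -(Pi.single i k : BlockIdx d (2 * n + 2)) : BlockIdx d (2 * n + 2)) i) =
        -(c i - k) - 1 := by
      simp only [Pi.add_apply, Pi.neg_apply, Pi.single_eq_same]; ring
    rw [e, zmod_val_neg_sub_one]
    omega

/-- **Admissibility for transverse bond planes**: a product of direction-`i` bond observables over cells mapped by
`g` into the negative half of `Θ_{j,k}`, read after the translation by `−(k−1)e_j`, depends only on the positive
links of the base bond reflection in the direction `j ≠ i`. [folklore] -/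
private theorem dependsOn_bondProd_translate {i j : Fin d} (hji : j ≠ i) (k : ZMod (2 * n + 2))
    {T : Finset (BlockIdx d (2 * n + 2))} (g : BlockIdx d (2 * n + 2) → BlockIdx d (2 * n + 2))
    (hg : ∀ c ∈ T, g c ∈ halfMinus (2 * n + 2) j k) (f : G → G → ℝ) :
    DependsOn (fun V : Config d L₀ (2 * n + 2) G =>
        ∏ c ∈ T, f (polyakovLine V (g c + -(Pi.single j (k - 1))))
          (polyakovLine V (g c + Pi.single i 1 + -(Pi.single j (k - 1)))))
      ((bondPos d L₀ n j : Finset _) : Set _) := by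
  intro V V' hVV'
  refine Finset.prod_congr rfl fun c hc => ?_
  have hmem : ∀ (y : BlockIdx d (2 * n + 2)), y ∈ halfMinus (2 * n + 2) j k → ∀ t : ZMod L₀,
      (((t, y + -(Pi.single j (k - 1) : BlockIdx d (2 * n + 2))), none) :
        FiniteTemperature.Site d L₀ (2 * n + 2) × Dir d) ∈ bondPos d L₀ n j := fun y hy t =>
    mem_bondPos.2 ⟨val_neg_sub_le j k hy, by simp⟩
  rw [polyakovLine_congr' (U := V) (V := V') fun t => hVV' _ (Finset.mem_coe.2 (hmem _ (hg c hc) t)),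
    polyakovLine_congr' (U := V) (V := V') fun t =>
      hVV' _ (Finset.mem_coe.2 (hmem _ (add_single_mem_halfMinus_of_ne hji (hg c hc)) t))]

/-- **Admissibility for the lattice planes in the bond direction**: a product of direction-`i` bond observables over
cells mapped by `g` into the negative half of `Σ_{i,k}`, read after the translation by `−k e_i`, depends only on the
links of the closed half of the base site reflection. [folklore] -/
private theorem dependsOn_bondProd_translate_site (i : Fin d) (k : ZMod (2 * n + 2))
    {T : Finset (BlockIdx d (2 * n + 2))} (g : BlockIdx d (2 * n + 2) → BlockIdx d (2 * n + 2))
    (hg : ∀ c ∈ T, g c ∈ halfMinus (2 * n + 2) i k) (f : G → G → ℝ) :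
    DependsOn (fun V : Config d L₀ (2 * n + 2) G =>
        ∏ c ∈ T, f (polyakovLine V (g c + -(Pi.single i k)))
          (polyakovLine V (g c + Pi.single i 1 + -(Pi.single i k))))
      ((sitePos d L₀ n i ∪ ∅ ∪ siteShared d L₀ n i : Finset _) : Set _) := by
  intro V V' hVV'
  refine Finset.prod_congr rfl fun c hc => ?_
  obtain ⟨h1, h2⟩ := val_neg_ends_le i k (hg c hc)
  rw [polyakovLine_congr' (U := V) (V := V') fun t =>
      hVV' _ (Finset.mem_coe.2 (timelike_mem_siteHalf (L₀ := L₀) i h1 t)),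
    polyakovLine_congr' (U := V) (V := V') fun t =>
      hVV' _ (Finset.mem_coe.2 (timelike_mem_siteHalf (L₀ := L₀) i h2 t))]

variable [TopologicalSpace G] [IsTopologicalGroup G] [CompactSpace G] [MeasurableSpace G] [BorelSpace G]
  [SecondCountableTopology G]

omit [CompactSpace G] in
/-- Bond products of a measurable `f` are measurable. [folklore] -/
private theorem measurable_bondProd {L : ℕ} [NeZero L] {ι : Type*} (s : Finset ι) (g g' : ι → Fin d → ZMod L)
    {f : G → G → ℝ} (hfm : Measurable (Function.uncurry f)) :
    Measurable fun U : Config d L₀ L G => ∏ c ∈ s, f (polyakovLine U (g c)) (polyakovLine U (g' c)) :=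
  Finset.measurable_prod _ fun _ _ =>
    hfm.comp ((continuous_timeHolonomy L₀ _).measurable.prodMk (continuous_timeHolonomy L₀ _).measurable)

omit [NeZero L₀] [TopologicalSpace G] [IsTopologicalGroup G] [CompactSpace G] [MeasurableSpace G] [BorelSpace G]
  [SecondCountableTopology G] in
/-- Bond products of an `f` with values in `[0,1]` take values in `[0,1]`. [folklore] -/
private theorem bondProd_mem {L : ℕ} {ι : Type*} (s : Finset ι) (g g' : ι → Fin d → ZMod L)
    {f : G → G → ℝ} (hf01 : ∀ a b, 0 ≤ f a b ∧ f a b ≤ 1) (U : Config d L₀ L G) :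
    0 ≤ ∏ c ∈ s, f (polyakovLine U (g c)) (polyakovLine U (g' c)) ∧
      ∏ c ∈ s, f (polyakovLine U (g c)) (polyakovLine U (g' c)) ≤ 1 :=
  ⟨Finset.prod_nonneg fun _ _ => (hf01 _ _).1,
    Finset.prod_le_one (fun _ _ => (hf01 _ _).1) fun _ _ => (hf01 _ _).2⟩

/-- ★ **The chessboard estimate for BOND functions of the Polyakov loops on the finite-temperature lattice**
(Tomboulis–Yaffe (2.7): "Similarly, for each spatial bond `⟨xy⟩` … let `f_{⟨xy⟩}(S_x, S_y)` be an arbitrary real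
function of the links in `S_x ∪ S_y`. Using reflections in timelike planes through lattice sites plus timelike dihedral
planes, one may derive the chessboard estimate for "bonds"", here for ONE symmetric `f` and the bonds of ONE direction
`i`, using the lattice planes in the direction `i` and the bond planes in the other directions instead of dihedral
planes): for a compact group, a continuous unitary `ρ`, `J_E, J_M ≥ 0`, an even spatial side `L_s = 2n + 2 ≥ 4`, a
measurable symmetric `f : G × G → [0,1]` with `⟨∏_c f(Ω[c], Ω[c+e_i])⟩ > 0`, and every set `T` of base points,
`⟨∏_{c∈T} f(Ω[c], Ω[c+e_i])⟩ ≤ ⟨∏_{c} f(Ω[c], Ω[c+e_i])⟩^{|T|/L_s^d}`. [cite: TomboulisYaffe1985, §II.A eq. (2.7) (p. 316); §III.C eq. (3.10) (p. 323)] [cite: FrohlichIsraelLiebSimon1978, Thm. 4.1] [cite: FriedliVelenik2017, Thm. 10.11] -/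
theorem expectation_polyakovBondProd_le_rpow (hρu : ∀ g, ρ g ∈ Matrix.unitaryGroup (Fin N) ℂ) (hρ : Continuous ρ)
    (hn : 1 ≤ n) {JE JM : ℝ} (hJE : 0 ≤ JE) (hJM : 0 ≤ JM) (i : Fin d) {f : G → G → ℝ}
    (hfm : Measurable (Function.uncurry f)) (hf01 : ∀ a b, 0 ≤ f a b ∧ f a b ≤ 1) (hfs : ∀ a b, f a b = f b a)
    (hpos : 0 < expectation ρ JE JM (fun U : Config d L₀ (2 * n + 2) G =>
      ∏ c : Fin d → ZMod (2 * n + 2), f (polyakovLine U c) (polyakovLine U (c + Pi.single i 1))))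
    (T : Finset (Fin d → ZMod (2 * n + 2))) :
    expectation ρ JE JM (fun U : Config d L₀ (2 * n + 2) G =>
        ∏ c ∈ T, f (polyakovLine U c) (polyakovLine U (c + Pi.single i 1))) ≤
      expectation ρ JE JM (fun U : Config d L₀ (2 * n + 2) G =>
          ∏ c : Fin d → ZMod (2 * n + 2), f (polyakovLine U c) (polyakovLine U (c + Pi.single i 1))) ^
        ((T.card : ℝ) / ((2 * n + 2 : ℕ) : ℝ) ^ d) := by
  classical
  have hN : Even (2 * n + 2) := ⟨n + 1, by ring⟩
  have hZ := partitionFunction_pos (d := d) (L₀ := L₀) (L := 2 * n + 2) ρ hρ JE JM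
  -- the bond observable of a set of cells and the set function
  set obs : Finset (BlockIdx d (2 * n + 2)) → Config d L₀ (2 * n + 2) G → ℝ := fun S U =>
    ∏ c ∈ S, f (polyakovLine U c) (polyakovLine U (c + Pi.single i 1)) with hobs
  set ψ : Finset (BlockIdx d (2 * n + 2)) → ℝ := fun S => expectation ρ JE JM (obs S) with hψ
  -- nonnegativity, normalisation, positivity
  have h0 : ∀ S, 0 ≤ ψ S := fun S => by
    simp only [hψ, hobs, expectation]
    exact div_nonneg (integral_nonneg fun U => mul_nonneg (bondProd_mem S id (fun c => c + Pi.single i 1) hf01 U).1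
      (weight_pos ρ JE JM U).le) hZ.le
  have hempty : ψ ∅ ≤ 1 := by
    have he : obs ∅ = fun _ : Config d L₀ (2 * n + 2) G => (1 : ℝ) := by
      funext U; simp [hobs]
    show expectation ρ JE JM (obs ∅) ≤ 1
    rw [he, expectation_const ρ hZ]
  have h1 : 0 < ψ Finset.univ := by simpa [hψ, hobs] using hpos
  -- the reflection Cauchy–Schwarz inequalities
  have hcs : ∀ (j : Fin d) (k : ZMod (2 * n + 2)) (S : Finset (BlockIdx d (2 * n + 2))),
      ψ S ^ 2 ≤ ψ (symP j k S) * ψ (symM j k S) := by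
    intro j k S
    set θk := cellReflect j k with hθk
    set Sp := S ∩ halfPlus (2 * n + 2) j k with hSp
    set Sm := S ∩ halfMinus (2 * n + 2) j k with hSm
    -- combinatorics of the halves (common to both cases)
    have hSsplit : S = Sm ∪ Sp := by
      ext c; simp only [hSp, hSm, Finset.mem_union, Finset.mem_inter]
      constructor
      · intro hc
        rcases mem_halfPlus_or_mem_halfMinus j k c with h | h
        · exact Or.inr ⟨hc, h⟩
        · exact Or.inl ⟨hc, h⟩
      · rintro (⟨hc, -⟩ | ⟨hc, -⟩) <;> exact hc
    have hSdisj : Disjoint Sm Sp := by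
      rw [hSm, hSp, Finset.disjoint_left]
      intro c hc hc'
      exact Finset.disjoint_left.1 (disjoint_halfPlus_halfMinus j k) (Finset.mem_inter.1 hc').2
        (Finset.mem_inter.1 hc).2
    have hPdisj : Disjoint Sp (Sp.image θk) := by
      rw [Finset.disjoint_left]
      intro c hc hc'
      obtain ⟨c', hc', hcc'⟩ := Finset.mem_image.1 hc'
      have h1 : c ∈ halfPlus (2 * n + 2) j k := (Finset.mem_inter.1 hc).2
      have h2 : c ∈ halfMinus (2 * n + 2) j k := hcc' ▸ cellReflect_mem_halfMinus hN (Finset.mem_inter.1 hc').2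
      exact Finset.disjoint_left.1 (disjoint_halfPlus_halfMinus j k) h1 h2
    have hMdisj : Disjoint Sm (Sm.image θk) := by
      rw [Finset.disjoint_left]
      intro c hc hc'
      obtain ⟨c', hc', hcc'⟩ := Finset.mem_image.1 hc'
      have h1 : c ∈ halfMinus (2 * n + 2) j k := (Finset.mem_inter.1 hc).2
      have h2 : c ∈ halfPlus (2 * n + 2) j k := hcc' ▸ cellReflect_mem_halfPlus hN (Finset.mem_inter.1 hc').2
      exact Finset.disjoint_left.1 (disjoint_halfPlus_halfMinus j k) h2 h1
    have hθinj : ∀ (R : Finset (BlockIdx d (2 * n + 2))), Set.InjOn θk R := fun R c _ c' _ h => θk.injective h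
    -- the two half observables: `F` on the negative half, `Gf` = the positive half read through `θ`
    set F : Config d L₀ (2 * n + 2) G → ℝ := fun U =>
      ∏ c ∈ Sm, f (polyakovLine U c) (polyakovLine U (c + Pi.single i 1)) with hF
    set Gf : Config d L₀ (2 * n + 2) G → ℝ := fun U =>
      ∏ c ∈ Sp, f (polyakovLine U (θk c)) (polyakovLine U (θk c + Pi.single i 1)) with hGf
    have hFb : ∀ U, |F U| ≤ 1 := fun U =>
      have h := bondProd_mem (L₀ := L₀) Sm id (fun c => c + Pi.single i 1) hf01 U
      abs_le.2 ⟨(neg_nonpos.2 zero_le_one).trans h.1, h.2⟩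
    have hGb : ∀ U, |Gf U| ≤ 1 := fun U =>
      have h := bondProd_mem (L₀ := L₀) Sp θk (fun c => θk c + Pi.single i 1) hf01 U
      abs_le.2 ⟨(neg_nonpos.2 zero_le_one).trans h.1, h.2⟩
    -- `ψ(symP S) = ⟨(∏_{θ Sp} f)(∏_{Sp} f)⟩`, `ψ(symM S) = ⟨(∏_{Sm} f)(∏_{θ Sm} f)⟩` as cell products
    have eP : ∀ U, obs (symP j k S) U = Gf U * ∏ c ∈ Sp, f (polyakovLine U c) (polyakovLine U (c + Pi.single i 1)) :=
      fun U => by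
      simp only [hobs, hGf]
      rw [symP, ← hSp, Finset.prod_union hPdisj, Finset.prod_image (hθinj Sp), mul_comm]
    have eM : ∀ U, obs (symM j k S) U = F U * ∏ c ∈ Sm, f (polyakovLine U (θk c)) (polyakovLine U (θk c + Pi.single i 1)) :=
      fun U => by
      simp only [hobs, hF]
      rw [symM, ← hSm, Finset.prod_union hMdisj, Finset.prod_image (hθinj Sm)]
    have eS : ∀ U, obs S U = F U * ∏ c ∈ Sp, f (polyakovLine U c) (polyakovLine U (c + Pi.single i 1)) :=
      fun U => by
      simp only [hobs, hF]
      rw [hSsplit, Finset.prod_union hSdisj]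
    by_cases hji : j = i
    · /- the LATTICE planes `x_i = k`, `x_i = k + L/2`: `Σ_{i,k}` reverses the segments, `f` is symmetric -/
      subst hji
      set Θ : Config d L₀ (2 * n + 2) G → Config d L₀ (2 * n + 2) G := fun U =>
        translate (-(Pi.single j k)) (spaceSiteReflect j (translate (Pi.single j k) U)) with hΘ
      have hΩ : ∀ U c, polyakovLine (Θ U) c = polyakovLine U (Function.update c j (2 * k - c j)) := fun U c =>
        polyakovLine_siteReflAt j k U c
      have e1 : ∀ U, obs S U = F U * Gf (Θ U) := fun U => by
        rw [eS U]
        congr 1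
        simp only [hGf, hΩ, hθk, update_cellReflect_eq_add, update_cellReflect_add_eq]
        exact Finset.prod_congr rfl fun c _ => hfs _ _
      have e2 : ∀ U, obs (symM j k S) U = F U * F (Θ U) := fun U => by
        rw [eM U]
        congr 1
        simp only [hF, hΩ, hθk]
        simp only [update_add_eq_cellReflect]
        simp only [update_eq_cellReflect_add]
        exact Finset.prod_congr rfl fun c _ => hfs _ _
      have e3 : ∀ U, obs (symP j k S) U = Gf U * Gf (Θ U) := fun U => by
        rw [eP U]
        congr 1
        simp only [hGf, hΩ, hθk, update_cellReflect_eq_add, update_cellReflect_add_eq]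
        exact Finset.prod_congr rfl fun c _ => hfs _ _
      -- the translated observables are admissible for the base site reflection
      set a : BlockIdx d (2 * n + 2) := Pi.single j k with ha
      set τ : Config d L₀ (2 * n + 2) G → Config d L₀ (2 * n + 2) G := translate (-a) with hτ
      have hFτ : ∀ V, F (τ V) = ∏ c ∈ Sm, f (polyakovLine V (id c + -a)) (polyakovLine V (id c + Pi.single j 1 + -a)) :=
        fun V => by simp only [hF, hτ, polyakovLine_translate, id]
      have hGτ : ∀ V, Gf (τ V) = ∏ c ∈ Sp, f (polyakovLine V (θk c + -a)) (polyakovLine V (θk c + Pi.single j 1 + -a)) :=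
        fun V => by simp only [hGf, hτ, polyakovLine_translate]
      have hFd : DependsOn (fun V => F (τ V)) ((sitePos d L₀ n j ∪ ∅ ∪ siteShared d L₀ n j : Finset _) : Set _) := by
        simp_rw [hFτ]
        exact dependsOn_bondProd_translate_site j k id (fun c hc => (Finset.mem_inter.1 hc).2) f
      have hGd : DependsOn (fun V => Gf (τ V)) ((sitePos d L₀ n j ∪ ∅ ∪ siteShared d L₀ n j : Finset _) : Set _) := by
        simp_rw [hGτ]
        exact dependsOn_bondProd_translate_site j k θk
          (fun c hc => cellReflect_mem_halfMinus hN (Finset.mem_inter.1 hc).2) f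
      have hτm : Measurable τ := measurable_translate (-a)
      have hFm : Measurable fun V => F (τ V) :=
        (measurable_bondProd Sm id (fun c => c + Pi.single j 1) hfm).comp hτm
      have hGm : Measurable fun V => Gf (τ V) :=
        (measurable_bondProd Sp θk (fun c => θk c + Pi.single j 1) hfm).comp hτm
      have key := sq_integral_mul_spaceSiteReflect_le (L₀ := L₀) ρ hρu hρ hn JE JM j hFm hGm
        (fun V => hFb (τ V)) (fun V => hGb (τ V)) hFd hGd
      have iS : ∫ U, obs S U * weight ρ JE JM U ∂haar d L₀ (2 * n + 2) G =
          ∫ V, F (τ V) * Gf (τ (spaceSiteReflect j V)) * weight ρ JE JM V ∂haar d L₀ (2 * n + 2) G := by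
        simp_rw [e1]; exact integral_siteReflAt ρ JE JM j k F Gf
      have iM : ∫ U, obs (symM j k S) U * weight ρ JE JM U ∂haar d L₀ (2 * n + 2) G =
          ∫ V, F (τ V) * F (τ (spaceSiteReflect j V)) * weight ρ JE JM V ∂haar d L₀ (2 * n + 2) G := by
        simp_rw [e2]; exact integral_siteReflAt ρ JE JM j k F F
      have iP : ∫ U, obs (symP j k S) U * weight ρ JE JM U ∂haar d L₀ (2 * n + 2) G =
          ∫ V, Gf (τ V) * Gf (τ (spaceSiteReflect j V)) * weight ρ JE JM V ∂haar d L₀ (2 * n + 2) G := by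
        simp_rw [e3]; exact integral_siteReflAt ρ JE JM j k Gf Gf
      simp only [hψ, expectation]
      rw [iS, iM, iP, div_pow, div_mul_div_comm, ← sq]
      exact div_le_div_of_nonneg_right (key.trans_eq (mul_comm _ _)) (sq_nonneg _)
    · /- the BOND planes `x_j = k − ½`, `x_j = k − ½ + L/2`, `j ≠ i`: `Θ_{j,k}` translates the segments -/
      set Θ : Config d L₀ (2 * n + 2) G → Config d L₀ (2 * n + 2) G := reflAt j k with hΘ
      have hΩ : ∀ U c, polyakovLine (Θ U) c = polyakovLine U (θk c) := fun U c => polyakovLine_reflAt j k U c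
      have hθadd : ∀ c, θk (c + Pi.single i 1) = θk c + Pi.single i 1 := fun c =>
        cellReflect_add_single_of_ne hji k c
      have hθθ : ∀ c, θk (θk c) = c := fun c => cellReflect_cellReflect j k c
      have e1 : ∀ U, obs S U = F U * Gf (Θ U) := fun U => by
        rw [eS U]
        congr 1
        simp only [hGf, hΩ, ← hθadd, hθθ]
      have e2 : ∀ U, obs (symM j k S) U = F U * F (Θ U) := fun U => by
        rw [eM U]
        congr 1
        simp only [hF, hΩ, hθadd]
      have e3 : ∀ U, obs (symP j k S) U = Gf U * Gf (Θ U) := fun U => by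
        rw [eP U]
        congr 1
        simp only [hGf, hΩ, ← hθadd, hθθ]
      set a : BlockIdx d (2 * n + 2) := Pi.single j (k - 1) with ha
      set τ : Config d L₀ (2 * n + 2) G → Config d L₀ (2 * n + 2) G := translate (-a) with hτ
      have hFτ : ∀ V, F (τ V) = ∏ c ∈ Sm, f (polyakovLine V (id c + -a)) (polyakovLine V (id c + Pi.single i 1 + -a)) :=
        fun V => by simp only [hF, hτ, polyakovLine_translate, id]
      have hGτ : ∀ V, Gf (τ V) = ∏ c ∈ Sp, f (polyakovLine V (θk c + -a)) (polyakovLine V (θk c + Pi.single i 1 + -a)) :=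
        fun V => by simp only [hGf, hτ, polyakovLine_translate]
      have hFd : DependsOn (fun V => F (τ V)) ((bondPos d L₀ n j : Finset _) : Set _) := by
        simp_rw [hFτ]
        exact dependsOn_bondProd_translate hji k id (fun c hc => (Finset.mem_inter.1 hc).2) f
      have hGd : DependsOn (fun V => Gf (τ V)) ((bondPos d L₀ n j : Finset _) : Set _) := by
        simp_rw [hGτ]
        exact dependsOn_bondProd_translate hji k θk
          (fun c hc => cellReflect_mem_halfMinus hN (Finset.mem_inter.1 hc).2) f
      have hτm : Measurable τ := measurable_translate (-a)
      have hFm : Measurable fun V => F (τ V) :=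
        (measurable_bondProd Sm id (fun c => c + Pi.single i 1) hfm).comp hτm
      have hGm : Measurable fun V => Gf (τ V) :=
        (measurable_bondProd Sp θk (fun c => θk c + Pi.single i 1) hfm).comp hτm
      have key := sq_integral_mul_spaceReflect_le (L₀ := L₀) ρ hρu hρ hJE hJM j hFm hGm
        (fun V => hFb (τ V)) (fun V => hGb (τ V)) hFd hGd
      have iS : ∫ U, obs S U * weight ρ JE JM U ∂haar d L₀ (2 * n + 2) G =
          ∫ V, F (τ V) * Gf (τ (spaceReflect j V)) * weight ρ JE JM V ∂haar d L₀ (2 * n + 2) G := by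
        simp_rw [e1]; exact integral_reflAt ρ JE JM j k F Gf
      have iM : ∫ U, obs (symM j k S) U * weight ρ JE JM U ∂haar d L₀ (2 * n + 2) G =
          ∫ V, F (τ V) * F (τ (spaceReflect j V)) * weight ρ JE JM V ∂haar d L₀ (2 * n + 2) G := by
        simp_rw [e2]; exact integral_reflAt ρ JE JM j k F F
      have iP : ∫ U, obs (symP j k S) U * weight ρ JE JM U ∂haar d L₀ (2 * n + 2) G =
          ∫ V, Gf (τ V) * Gf (τ (spaceReflect j V)) * weight ρ JE JM V ∂haar d L₀ (2 * n + 2) G := by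
        simp_rw [e3]; exact integral_reflAt ρ JE JM j k Gf Gf
      simp only [hψ, expectation]
      rw [iS, iM, iP, div_pow, div_mul_div_comm, ← sq]
      exact div_le_div_of_nonneg_right (key.trans_eq (mul_comm _ _)) (sq_nonneg _)
  have h := chessboard_le_rpow_even hN h0 hempty h1 hcs T
  simpa [hψ, hobs] using h

end BondChessboard

/-! ### §6 (appended) Positivity of pattern expectations -/

section Positivity

variable {d L₀ L : ℕ} [NeZero L₀] [NeZero L] {G : Type*} [Group G] [TopologicalSpace G] [IsTopologicalGroup G]
  [CompactSpace G] [MeasurableSpace G] [BorelSpace G] [SecondCountableTopology G] {N : ℕ}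
  (ρ : G →* Matrix (Fin N) (Fin N) ℂ)

omit [SecondCountableTopology G] in
/-- The a-priori measure `∏ dg` charges non-empty open sets (a product of Haar measures). [cite: BorgsSeiler1983, §II.3 (II.20)–Lemma II.3 (p. 336)] -/
theorem haar_isOpenPosMeasure : (haar d L₀ L G).IsOpenPosMeasure := by
  haveI : (haarProbability G).IsOpenPosMeasure := by unfold haarProbability; infer_instance
  unfold haar; infer_instance

/-- **The expectation of an event containing a non-empty open set is positive** (the weight is continuous and
positive on a compact configuration space, `∏dg` charges open sets; expectations are genuine averages, `Z > 0`).
[cite: BorgsSeiler1983, §II.3 (II.22) and Lemma II.3 (pp. 336–337)] -/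
theorem expectation_indicator_pos (hρ : Continuous ρ) (JE JM : ℝ) {E O : Set (Config d L₀ L G)}
    (hE : MeasurableSet E) (hO : IsOpen O) (hne : O.Nonempty) (hOE : O ⊆ E) :
    0 < expectation ρ JE JM (E.indicator 1) := by
  haveI := haar_isOpenPosMeasure (d := d) (L₀ := L₀) (L := L) (G := G)
  have hZ := partitionFunction_pos (d := d) (L₀ := L₀) (L := L) ρ hρ JE JM
  unfold expectation
  refine div_pos ?_ hZ
  -- a positive lower bound of the weight
  obtain ⟨U₀, -, hU₀⟩ := isCompact_univ.exists_isMinOn Set.univ_nonempty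
    (continuous_weight (d := d) (L₀ := L₀) (L := L) ρ hρ JE JM).continuousOn
  set m : ℝ := weight ρ JE JM U₀ with hm
  have hmpos : 0 < m := weight_pos ρ JE JM U₀
  have hmle : ∀ U, m ≤ weight ρ JE JM U := fun U => hU₀ (Set.mem_univ U)
  have hμO : 0 < (haar d L₀ L G).real O :=
    ENNReal.toReal_pos (hO.measure_pos (haar d L₀ L G) hne).ne' (measure_ne_top _ _)
  have hint : Integrable (fun U => E.indicator (1 : Config d L₀ L G → ℝ) U * weight ρ JE JM U) (haar d L₀ L G) := by
    refine integrable_mul_weight ρ hρ JE JM ((aestronglyMeasurable_indicator_iff hE).2 aestronglyMeasurable_const)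
      (C := 1) fun U => ?_
    by_cases hU : U ∈ E
    · rw [Set.indicator_of_mem hU]; simp
    · rw [Set.indicator_of_notMem hU]; simp
  calc (0 : ℝ) < m * (haar d L₀ L G).real O := mul_pos hmpos hμO
    _ = ∫ U, O.indicator (fun _ => m) U ∂haar d L₀ L G := by
        rw [integral_indicator_const _ hO.measurableSet, smul_eq_mul, mul_comm]
    _ ≤ ∫ U, E.indicator (1 : Config d L₀ L G → ℝ) U * weight ρ JE JM U ∂haar d L₀ L G := by
        refine integral_mono ((integrable_const m).indicator hO.measurableSet) hint fun U => ?_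
        by_cases hU : U ∈ O
        · rw [Set.indicator_of_mem hU, Set.indicator_of_mem (hOE hU), Pi.one_apply, one_mul]
          exact hmle U
        · rw [Set.indicator_of_notMem hU]
          by_cases hU' : U ∈ E
          · rw [Set.indicator_of_mem hU', Pi.one_apply, one_mul]; exact (weight_pos ρ JE JM U).le
          · rw [Set.indicator_of_notMem hU', zero_mul]

/-- **The expectation of a continuous non-negative observable which is positive somewhere is positive.**
[cite: BorgsSeiler1983, §II.3 (II.22) and Lemma II.3 (pp. 336–337)] -/
theorem expectation_pos_of_continuous (hρ : Continuous ρ) (JE JM : ℝ) {F : Config d L₀ L G → ℝ}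
    (hF : Continuous F) (h0 : ∀ U, 0 ≤ F U) {U₀ : Config d L₀ L G} (hU₀ : 0 < F U₀) :
    0 < expectation ρ JE JM F := by
  haveI := haar_isOpenPosMeasure (d := d) (L₀ := L₀) (L := L) (G := G)
  have hZ := partitionFunction_pos (d := d) (L₀ := L₀) (L := L) ρ hρ JE JM
  unfold expectation
  refine div_pos ?_ hZ
  have hc : Continuous fun U => F U * weight ρ JE JM U := hF.mul (continuous_weight ρ hρ JE JM)
  refine hc.integral_pos_of_hasCompactSupport_nonneg_nonzero
    (IsCompact.of_isClosed_subset isCompact_univ (isClosed_tsupport _) (Set.subset_univ _))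
    (fun U => mul_nonneg (h0 U) (weight_pos ρ JE JM U).le) (x := U₀) ?_
  exact (mul_pos hU₀ (weight_pos ρ JE JM U₀)).ne'

omit [NeZero L] [TopologicalSpace G] [IsTopologicalGroup G] [CompactSpace G] [MeasurableSpace G] [BorelSpace G]
  [SecondCountableTopology G] in
/-- The Polyakov loop of a configuration whose time-like links are trivial except at time `0` is the time-`0` link
(the loop is the ordered product of the `L₀` time-like links above the site). [cite: BorgsSeiler1983, §II.3 Lemma II.4 and Remark 1 (p. 336)] -/
theorem polyakovLine_of_trivial_above (U : Config d L₀ L G)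
    (hU : ∀ (t : ZMod L₀) (x : Fin d → ZMod L), t ≠ 0 → U ((t, x), none) = 1) (x : Fin d → ZMod L) :
    polyakovLine U x = U (((0 : ZMod L₀), x), none) := by
  -- holonomies starting at a time `t = s` with `s + m ≤ L₀`, `s ≥ 1`, are trivial
  have key : ∀ (m s : ℕ), 1 ≤ s → s + m ≤ L₀ → timeHolonomy U m ((s : ZMod L₀), x) = 1 := by
    intro m
    induction m with
    | zero => intro s _ _; rfl
    | succ m ih =>
        intro s hs hsm
        simp only [timeHolonomy, FiniteTemperature.Site.shift]
        have hs0 : ((s : ℕ) : ZMod L₀) ≠ 0 := by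
          intro h
          rw [ZMod.natCast_eq_zero_iff] at h
          exact absurd (Nat.le_of_dvd (by omega) h) (by omega)
        rw [hU _ _ hs0, one_mul]
        have e : ((s : ℕ) : ZMod L₀) + 1 = ((s + 1 : ℕ) : ZMod L₀) := by push_cast; ring
        rw [e]
        exact ih (s + 1) (by omega) (by omega)
  have hL₀ : 1 ≤ L₀ := Nat.one_le_iff_ne_zero.2 (NeZero.ne L₀)
  obtain ⟨m, rfl⟩ : ∃ m, L₀ = m + 1 := ⟨L₀ - 1, by omega⟩
  unfold polyakovLine
  simp only [timeHolonomy, FiniteTemperature.Site.shift]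
  have e : (0 : ZMod (m + 1)) + 1 = ((1 : ℕ) : ZMod (m + 1)) := by push_cast; ring
  rw [e, key m 1 le_rfl (by omega), mul_one]

end Positivity

/-! ### §7 (appended) `SU(2)`: Tomboulis–Yaffe's disorder bounds (3.25)–(3.26) REDUCED to two full-lattice
pattern bounds, and the removal of the magnetic coupling

The typed prerequisite `X = TY85DisorderBounds` of `SU2HighTemperaturePeierlsReduction` (its hypothesis binder: the
point-defect bound (3.25) `⟨1 − |½trΩ[0]|⟩ ≤ K` and the contour bound (3.26) `⟨walls across B⟩ ≤ K^{|B|}` for EVERY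
bond set `B`, uniformly in `L_s`) follows — by the site chessboard of §3 and the bond chessboard of §5 — from two
THERMODYNAMIC bounds in each box: `⟨∏_x (1 − |½trΩ[x]|)⟩ ≤ K^{L_s^d}` (TY (3.23)) and, for each axis `i`,
`⟨every bond ⟨y, y+e_i⟩ is a domain wall⟩ ≤ K^{d·L_s^d}` (the one-axis form of TY (3.24)); and these may be taken
at ZERO magnetic coupling `J_M = 0` (where the space-like links integrate exactly, TY (3.16)), since
`⟨F⟩_{J_E,J_M} ≤ e^{8 J_M |Λ| d²}⟨F⟩_{J_E,0}` for `F ≥ 0` and the factor is harmless after the `L_s^d`-th root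
along TY's hyperbola `J_M = γ/θ → 0`. No named fact is introduced; the theorems below have the remaining analytic
estimate as an explicit hypothesis. -/

section SU2Patterns

open Literature.MathematicalPhysics.QuantumLattice (fundamentalRep continuous_fundamentalRep
  fundamentalRep_mem_unitaryGroup)

variable {d L₀ : ℕ} [NeZero L₀]

/-- The class function `1 − |½ Re tr g|` on `SU(2)`, with values in `[0,1]`. [cite: TomboulisYaffe1985, §III.C eq. (3.9) (p. 323)] -/
private theorem pointDefectFun_mem (g : SU2) :
    0 ≤ 1 - |((fundamentalRep (Fin 2) g).trace.re) / 2| ∧ 1 - |((fundamentalRep (Fin 2) g).trace.re) / 2| ≤ 1 := by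
  have h : ‖(fundamentalRep (Fin 2) g).trace‖ ≤ (2 : ℕ) :=
    norm_trace_le_of_mem_unitaryGroup (fundamentalRep_mem_unitaryGroup _)
  have h' := (Complex.abs_re_le_norm _).trans h
  push_cast at h'
  have h0 := abs_nonneg ((fundamentalRep (Fin 2) g).trace.re)
  rw [abs_div, abs_two]
  constructor <;> linarith

omit [NeZero L₀] in
/-- `1 − |½trΩ[x]|` is this class function of the Polyakov loop. [cite: TomboulisYaffe1985, §III.C eq. (3.9) (p. 323)] -/
private theorem pointDefectFun_polyakovLine {L : ℕ} (U : Config d L₀ L SU2) (x : Fin d → ZMod L) :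
    1 - |((fundamentalRep (Fin 2) (polyakovLine U x)).trace.re) / 2| = 1 - |halfTrace U x| := rfl

omit [NeZero L₀] in
/-- The half-trace depends continuously on the configuration. [folklore] -/
private theorem continuous_halfTrace' {L : ℕ} (y : Fin d → ZMod L) :
    Continuous fun U : Config d L₀ L SU2 => halfTrace U y :=
  (Complex.continuous_re.comp (continuous_polyakovTrace (fundamentalRep (Fin 2))
    (continuous_fundamentalRep (Fin 2)) y)).div_const 2

/-- `−𝟙 ∈ SU(2)`. [folklore] -/
private theorem neg_one_mem_SU2 : (-1 : Matrix (Fin 2) (Fin 2) ℂ) ∈ Matrix.specialUnitaryGroup (Fin 2) ℂ := by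
  rw [Matrix.mem_specialUnitaryGroup_iff]
  refine ⟨?_, ?_⟩
  · rw [Matrix.mem_unitaryGroup_iff]; simp
  · rw [Matrix.det_neg, Matrix.det_one]; simp

/-- `diag(i, −i) ∈ SU(2)` (a trace-zero element). [folklore] -/
private theorem diagI_mem_SU2 : (!![Complex.I, 0; 0, -Complex.I] : Matrix (Fin 2) (Fin 2) ℂ) ∈
    Matrix.specialUnitaryGroup (Fin 2) ℂ := by
  rw [Matrix.mem_specialUnitaryGroup_iff]
  refine ⟨?_, ?_⟩
  · rw [Matrix.mem_unitaryGroup_iff]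
    ext a b
    fin_cases a <;> fin_cases b <;>
      simp [Matrix.mul_apply, Fin.sum_univ_two, Matrix.star_apply]
  · simp [Matrix.det_fin_two]

/-- The domain-wall event of a finite bond set is measurable. [folklore] -/
private theorem measurableSet_wallEvent' {L : ℕ} [NeZero L] (B : Finset ((Fin d → ZMod L) × Fin d)) :
    MeasurableSet (wallEvent (d := d) (L₀ := L₀) (L := L) B) := by
  have hh : ∀ y : Fin d → ZMod L, MeasurableSet {U : Config d L₀ L SU2 | 0 ≤ halfTrace U y} := fun y =>
    (isClosed_le continuous_const (continuous_halfTrace' y)).measurableSet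
  have h : wallEvent (d := d) (L₀ := L₀) (L := L) B =
      ⋂ b ∈ B, symmDiff {U | 0 ≤ halfTrace U b.1} {U | 0 ≤ halfTrace U (b.1 + Pi.single b.2 1)} := by
    ext U
    simp only [wallEvent, Set.mem_setOf_eq, Set.mem_iInter, Set.mem_symmDiff]
    exact forall₂_congr fun b _ => by tauto
  rw [h]
  exact Finset.measurableSet_biInter B fun b _ => (hh _).symmDiff (hh _)

/-- **`⟨∏_x (1 − |½trΩ[x]|)⟩ > 0`** (the thermodynamic quantity of TY (3.9) is a genuine positive number: the
pattern is witnessed by the configuration whose time-`0` links are `diag(i, −i)` and all other links trivial).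
[cite: TomboulisYaffe1985, §III.C eq. (3.9) (p. 323)] -/
theorem expectation_pointDefectPattern_pos {L : ℕ} [NeZero L] (JE JM : ℝ) :
    0 < expectation (fundamentalRep (Fin 2)) JE JM
      (fun U : Config d L₀ L SU2 => ∏ x, (1 - |halfTrace U x|)) := by
  set g₀ : SU2 := ⟨!![Complex.I, 0; 0, -Complex.I], diagI_mem_SU2⟩ with hg₀
  set U₀ : Config d L₀ L SU2 := fun e => if e.1.1 = 0 ∧ e.2 = none then g₀ else 1 with hU₀
  have hΩ : ∀ x, polyakovLine U₀ x = g₀ := fun x => by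
    rw [polyakovLine_of_trivial_above U₀ (fun t x ht => by simp [hU₀, ht])]
    simp [hU₀]
  have hh : ∀ x, halfTrace U₀ x = 0 := fun x => by
    unfold halfTrace polyakovTrace
    rw [hΩ x, Literature.MathematicalPhysics.QuantumLattice.fundamentalRep_apply, hg₀]
    simp [Matrix.trace_fin_two]
  refine expectation_pos_of_continuous (fundamentalRep (Fin 2)) (continuous_fundamentalRep (Fin 2)) JE JM
    (continuous_finsetProd _ fun x _ => continuous_const.sub (continuous_halfTrace' x).abs)
    (fun U => Finset.prod_nonneg fun x _ => ?_) (U₀ := U₀) ?_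
  · have := abs_halfTrace_le_one U x; linarith
  · simp [hh]

/-- Parity flips along a lattice axis of even length: `(v + 1).val` is even iff `v.val` is odd. [folklore] -/
private theorem even_val_add_one_iff {n : ℕ} (v : ZMod (2 * n + 2)) : Even (v + 1).val ↔ ¬ Even v.val := by
  have hv := ZMod.val_lt v
  rw [ZMod.val_add, ZMod.val_one_eq_one_mod, Nat.one_mod_eq_one.2 (by omega)]
  rcases Nat.lt_or_ge (v.val + 1) (2 * n + 2) with h | h
  · rw [Nat.mod_eq_of_lt h, Nat.even_add_one]
  · have hv' : v.val + 1 = 2 * n + 2 := by omega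
    rw [hv', Nat.mod_self]
    simp only [Even.zero, true_iff]
    rw [Nat.even_iff]
    omega

/-- **`⟨every bond ⟨y, y + e_i⟩ is a domain wall⟩ > 0`** on a box of even side (the thermodynamic quantity of the
one-axis form of TY (3.10) is a genuine positive number: the event contains the open set of configurations whose
half-traces alternate strictly in sign along the axis `i`, witnessed by time-`0` links `±𝟙`).
[cite: TomboulisYaffe1985, §III.C eq. (3.10) (p. 323)] -/
theorem expectation_wallPattern_pos {n : ℕ} (JE JM : ℝ) (i : Fin d) :
    0 < expectation (fundamentalRep (Fin 2)) JE JM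
      ((wallEvent (d := d) (L₀ := L₀) (L := 2 * n + 2)
        ((Finset.univ : Finset (Fin d → ZMod (2 * n + 2))) ×ˢ {i})).indicator 1) := by
  classical
  -- the sign pattern and the open set
  set sgn : (Fin d → ZMod (2 * n + 2)) → ℝ := fun x => if Even (x i).val then 1 else -1 with hsgn
  set O : Set (Config d L₀ (2 * n + 2) SU2) := {U | ∀ x, 0 < sgn x * halfTrace U x} with hO
  have hOopen : IsOpen O := by
    have e : O = ⋂ x, {U : Config d L₀ (2 * n + 2) SU2 | 0 < sgn x * halfTrace U x} := by
      ext U; simp [hO]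
    rw [e]
    exact isOpen_iInter_of_finite fun x => isOpen_lt continuous_const (continuous_const.mul (continuous_halfTrace' x))
  -- a witness: time-`0` links `±1` following the parity of `x_i`
  set gm : SU2 := ⟨-1, neg_one_mem_SU2⟩ with hgm
  set U₀ : Config d L₀ (2 * n + 2) SU2 := fun e =>
    if e.1.1 = 0 ∧ e.2 = none then (if Even (e.1.2 i).val then 1 else gm) else 1 with hU₀
  have hΩ : ∀ x, polyakovLine U₀ x = if Even (x i).val then 1 else gm := fun x => by
    rw [polyakovLine_of_trivial_above U₀ (fun t x ht => by simp [hU₀, ht])]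
    simp [hU₀]
  have hh : ∀ x, halfTrace U₀ x = sgn x := fun x => by
    unfold halfTrace polyakovTrace
    rw [hΩ x, Literature.MathematicalPhysics.QuantumLattice.fundamentalRep_apply]
    by_cases hx : Even (x i).val
    · simp [hsgn, hx]
    · simp [hsgn, hx, hgm]
  have hne : O.Nonempty := ⟨U₀, fun x => by
    rw [hh x, hsgn]
    by_cases hx : Even (x i).val <;> simp [hx]⟩
  -- the open set lies in the wall event
  have hOE : O ⊆ wallEvent ((Finset.univ : Finset (Fin d → ZMod (2 * n + 2))) ×ˢ {i}) := by
    intro U hU b hb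
    obtain ⟨-, hbi⟩ := Finset.mem_product.1 hb
    rw [Finset.mem_singleton] at hbi
    rw [hbi]
    have h1 := hU b.1
    have h2 := hU (b.1 + Pi.single i 1)
    have hpar : sgn (b.1 + Pi.single i 1) = -sgn b.1 := by
      simp only [hsgn, Pi.add_apply, Pi.single_eq_same, even_val_add_one_iff]
      by_cases hx : Even (b.1 i).val <;> simp [hx]
    rw [hpar] at h2
    by_cases hx : Even (b.1 i).val
    · simp only [hsgn, hx, if_true, one_mul, neg_mul, neg_pos] at h1 h2
      intro h; exact absurd (h.1 h1.le) (not_le.2 h2)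
    · simp only [hsgn, hx, if_false, neg_mul, one_mul, neg_pos, neg_neg] at h1 h2
      intro h; exact absurd (h.2 h2.le) (not_le.2 h1)
  exact expectation_indicator_pos (fundamentalRep (Fin 2)) (continuous_fundamentalRep (Fin 2)) JE JM
    (measurableSet_wallEvent' _) hOopen hne hOE

end SU2Patterns

/-! ### §8 (appended) The disorder bounds (3.25)–(3.26) from the pattern bounds; removal of the magnetic coupling -/

section MagneticRemoval

variable {d L₀ L : ℕ} [NeZero L₀] [NeZero L] {G : Type*} [Group G] [TopologicalSpace G] [IsTopologicalGroup G]
  [CompactSpace G] [MeasurableSpace G] [BorelSpace G] [SecondCountableTopology G] {N : ℕ}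
  (ρ : G →* Matrix (Fin N) (Fin N) ℂ)

omit [TopologicalSpace G] [IsTopologicalGroup G] [CompactSpace G] [MeasurableSpace G] [BorelSpace G]
  [SecondCountableTopology G] in
/-- The action splits as the electric part plus `J_M` times the magnetic plaquette sum. [cite: BorgsSeiler1983, §II.3 (II.20) (pp. 335–336)] -/
theorem minusAction_eq_electric_add_magnetic (JE JM : ℝ) (U : Config d L₀ L G) :
    minusAction ρ JE JM U = minusAction ρ JE 0 U +
      JM * ∑ x : FiniteTemperature.Site d L₀ L, ∑ p : {p : Fin d × Fin d // p.1 < p.2},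
        (ρ (plaquette U x (some p.1.1) (some p.1.2))).trace.re := by
  unfold minusAction; ring

omit [TopologicalSpace G] [IsTopologicalGroup G] [CompactSpace G] [MeasurableSpace G] [BorelSpace G]
  [SecondCountableTopology G] in
/-- The magnetic plaquette sum is bounded by `N · #sites · #{i<j}` for a unitary `ρ` (`|Re χ(g_{∂P})| ≤ N`).
[cite: BorgsSeiler1983, §II.3 (II.20) (pp. 335–336)] -/
theorem abs_magneticSum_le (hρu : ∀ g, ρ g ∈ Matrix.unitaryGroup (Fin N) ℂ) (U : Config d L₀ L G) :
    |∑ x : FiniteTemperature.Site d L₀ L, ∑ p : {p : Fin d × Fin d // p.1 < p.2},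
        (ρ (plaquette U x (some p.1.1) (some p.1.2))).trace.re| ≤
      N * (Fintype.card (FiniteTemperature.Site d L₀ L) * Fintype.card {p : Fin d × Fin d // p.1 < p.2}) := by
  have hterm : ∀ (x : FiniteTemperature.Site d L₀ L) (p : {p : Fin d × Fin d // p.1 < p.2}),
      |(ρ (plaquette U x (some p.1.1) (some p.1.2))).trace.re| ≤ N := fun x p =>
    (Complex.abs_re_le_norm _).trans (norm_trace_le_of_mem_unitaryGroup (hρu _))
  calc |∑ x : FiniteTemperature.Site d L₀ L, ∑ p : {p : Fin d × Fin d // p.1 < p.2},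
          (ρ (plaquette U x (some p.1.1) (some p.1.2))).trace.re|
      ≤ ∑ x : FiniteTemperature.Site d L₀ L, |∑ p : {p : Fin d × Fin d // p.1 < p.2},
          (ρ (plaquette U x (some p.1.1) (some p.1.2))).trace.re| := Finset.abs_sum_le_sum_abs _ _
    _ ≤ ∑ x : FiniteTemperature.Site d L₀ L, ∑ p : {p : Fin d × Fin d // p.1 < p.2}, (N : ℝ) :=
        Finset.sum_le_sum fun x _ => (Finset.abs_sum_le_sum_abs _ _).trans (Finset.sum_le_sum fun p _ => hterm x p)
    _ = N * (Fintype.card (FiniteTemperature.Site d L₀ L) * Fintype.card {p : Fin d × Fin d // p.1 < p.2}) := by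
        simp only [Finset.sum_const, Finset.card_univ, nsmul_eq_mul]
        ring

/-- **Removal of the magnetic coupling**: for a non-negative bounded measurable observable `F` and `J_M ≥ 0`,
`⟨F⟩_{J_E,J_M} ≤ exp(2 J_M · N·#sites·#{i<j}) · ⟨F⟩_{J_E,0}` (the Boltzmann factors differ by `e^{±J_M·(bound)}`;
Tomboulis–Yaffe: "To derive an upper bound, we may simply set `β_s` to zero", App. III.A p. 334 — here for the
normalised expectation, the lower bound on `Z` costing the same factor). [cite: TomboulisYaffe1985, App. III.A (p. 334)] -/
theorem expectation_le_exp_mul_expectation_electric (hρu : ∀ g, ρ g ∈ Matrix.unitaryGroup (Fin N) ℂ) (hρ : Continuous ρ)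
    {JE JM : ℝ} (hJM : 0 ≤ JM) {F : Config d L₀ L G → ℝ} (hFm : AEStronglyMeasurable F (haar d L₀ L G))
    {C : ℝ} (hFb : ∀ U, |F U| ≤ C) (hF0 : ∀ U, 0 ≤ F U) :
    expectation ρ JE JM F ≤
      Real.exp (2 * JM * (N * (Fintype.card (FiniteTemperature.Site d L₀ L) * Fintype.card {p : Fin d × Fin d // p.1 < p.2}))) *
        expectation ρ JE 0 F := by
  set M : ℝ := N * (Fintype.card (FiniteTemperature.Site d L₀ L) * Fintype.card {p : Fin d × Fin d // p.1 < p.2}) with hM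
  have hZ0 := partitionFunction_pos (d := d) (L₀ := L₀) (L := L) ρ hρ JE 0
  have hZ := partitionFunction_pos (d := d) (L₀ := L₀) (L := L) ρ hρ JE JM
  -- the two-sided comparison of the weights
  have hw : ∀ U, weight ρ JE JM U ≤ Real.exp (JM * M) * weight ρ JE 0 U ∧
      Real.exp (-(JM * M)) * weight ρ JE 0 U ≤ weight ρ JE JM U := fun U => by
    have hS := abs_le.1 (abs_magneticSum_le (d := d) (L₀ := L₀) (L := L) ρ hρu U)
    rw [weight, weight, minusAction_eq_electric_add_magnetic ρ JE JM U, Real.exp_add, mul_comm]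
    constructor
    · refine mul_le_mul_of_nonneg_right (Real.exp_le_exp.2 ?_) (Real.exp_pos _).le
      rw [← hM] at hS
      nlinarith [hS.2]
    · refine mul_le_mul_of_nonneg_right (Real.exp_le_exp.2 ?_) (Real.exp_pos _).le
      rw [← hM] at hS
      nlinarith [hS.1]
  have hiF0 := integrable_mul_weight ρ hρ JE 0 hFm hFb
  have hiF := integrable_mul_weight ρ hρ JE JM hFm hFb
  have hiw0 := integrable_of_continuous (d := d) (L₀ := L₀) (L := L) (continuous_weight ρ hρ JE 0)
  have hiw := integrable_of_continuous (d := d) (L₀ := L₀) (L := L) (continuous_weight ρ hρ JE JM)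
  -- numerator and denominator
  have hnum : ∫ U, F U * weight ρ JE JM U ∂haar d L₀ L G ≤
      Real.exp (JM * M) * ∫ U, F U * weight ρ JE 0 U ∂haar d L₀ L G := by
    rw [← integral_const_mul]
    refine integral_mono hiF (hiF0.const_mul _) fun U => ?_
    have := mul_le_mul_of_nonneg_left (hw U).1 (hF0 U)
    simpa only [mul_assoc, mul_left_comm (F U)] using this
  have hden : Real.exp (-(JM * M)) * ∫ U, weight ρ JE 0 U ∂haar d L₀ L G ≤
      ∫ U, weight ρ JE JM U ∂haar d L₀ L G := by
    rw [← integral_const_mul]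
    exact integral_mono (hiw0.const_mul _) hiw fun U => (hw U).2
  have hnum0 : 0 ≤ ∫ U, F U * weight ρ JE 0 U ∂haar d L₀ L G :=
    integral_nonneg fun U => mul_nonneg (hF0 U) (weight_pos ρ JE 0 U).le
  have hden' : 0 < Real.exp (-(JM * M)) * ∫ U, weight ρ JE 0 U ∂haar d L₀ L G := mul_pos (Real.exp_pos _) hZ0
  unfold expectation
  calc (∫ U, F U * weight ρ JE JM U ∂haar d L₀ L G) / ∫ U, weight ρ JE JM U ∂haar d L₀ L G
      ≤ (Real.exp (JM * M) * ∫ U, F U * weight ρ JE 0 U ∂haar d L₀ L G) /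
          (Real.exp (-(JM * M)) * ∫ U, weight ρ JE 0 U ∂haar d L₀ L G) :=
        div_le_div₀ (mul_nonneg (Real.exp_pos _).le hnum0) hnum hden' hden
    _ = Real.exp (2 * JM * M) * ((∫ U, F U * weight ρ JE 0 U ∂haar d L₀ L G) / ∫ U, weight ρ JE 0 U ∂haar d L₀ L G) := by
        rw [mul_div_mul_comm, ← Real.exp_sub]
        congr 1; ring_nf

end MagneticRemoval

section SU2Reduction

open Literature.MathematicalPhysics.QuantumLattice (fundamentalRep continuous_fundamentalRep
  fundamentalRep_mem_unitaryGroup)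

variable {d L₀ : ℕ} [NeZero L₀] {n : ℕ}

/-- ★ **(3.25) from the point-pattern bound**: if `⟨∏_x (1 − |½trΩ[x]|)⟩ ≤ K^{L_s^d}` in the box of even side
`L_s = 2n+2` (`J_E, J_M ≥ 0`, `K ≥ 0`), then `⟨1 − |½trΩ[x]|⟩ ≤ K` at every site — TY (3.9) and the root.
[cite: TomboulisYaffe1985, §III.C eqs. (3.9), (3.23), (3.25) (pp. 323–325)] -/
theorem expectation_pointDefect_le_of_patternBound {L : ℕ} [NeZero L] (hL : L = 2 * n + 2)
    {JE JM K : ℝ} (hJE : 0 ≤ JE) (hJM : 0 ≤ JM) (hK : 0 ≤ K)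
    (h : expectation (fundamentalRep (Fin 2)) JE JM (fun U : Config d L₀ L SU2 => ∏ x, (1 - |halfTrace U x|)) ≤
      K ^ L ^ d)
    (x : Fin d → ZMod L) :
    expectation (fundamentalRep (Fin 2)) JE JM (fun U : Config d L₀ L SU2 => 1 - |halfTrace U x|) ≤ K := by
  subst hL
  set f : SU2 → ℝ := fun g => 1 - |((fundamentalRep (Fin 2) g).trace.re) / 2| with hf
  have hfc : Continuous f :=
    continuous_const.sub ((Complex.continuous_re.comp (continuous_fundamentalRep (Fin 2)).matrix_trace).div_const 2).abs
  have hf01 : ∀ g, 0 ≤ f g ∧ f g ≤ 1 := pointDefectFun_mem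
  have hprod : polyakovProd (d := d) (L₀ := L₀) f (Finset.univ : Finset (Fin d → ZMod (2 * n + 2))) =
      fun U => ∏ x, (1 - |halfTrace U x|) := by
    funext U; simp only [polyakovProd, hf, pointDefectFun_polyakovLine]
  have hpos : 0 < expectation (fundamentalRep (Fin 2)) JE JM
      (polyakovProd (d := d) (L₀ := L₀) f (Finset.univ : Finset (Fin d → ZMod (2 * n + 2)))) := by
    rw [hprod]; exact expectation_pointDefectPattern_pos JE JM
  have key := expectation_polyakov_le_rpow (L₀ := L₀) (fundamentalRep (Fin 2)) fundamentalRep_mem_unitaryGroup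
    (continuous_fundamentalRep (Fin 2)) hJE hJM hfc.measurable hf01 hpos x
  rw [hprod] at key
  have hlhs : (fun U : Config d L₀ (2 * n + 2) SU2 => f (polyakovLine U x)) = fun U => 1 - |halfTrace U x| := by
    funext U; exact pointDefectFun_polyakovLine U x
  rw [hlhs] at key
  refine key.trans ?_
  have hNd : (0 : ℝ) < ((2 * n + 2 : ℕ) : ℝ) ^ d := by positivity
  have hE0 : 0 ≤ expectation (fundamentalRep (Fin 2)) JE JM
      (fun U : Config d L₀ (2 * n + 2) SU2 => ∏ x, (1 - |halfTrace U x|)) := by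
    rw [← hprod]; exact hpos.le
  calc expectation (fundamentalRep (Fin 2)) JE JM
          (fun U : Config d L₀ (2 * n + 2) SU2 => ∏ x, (1 - |halfTrace U x|)) ^
        ((1 : ℝ) / ((2 * n + 2 : ℕ) : ℝ) ^ d)
      ≤ (K ^ (2 * n + 2) ^ d) ^ ((1 : ℝ) / ((2 * n + 2 : ℕ) : ℝ) ^ d) :=
        Real.rpow_le_rpow hE0 h (by positivity)
    _ = K := by
        rw [← Real.rpow_natCast K ((2 * n + 2) ^ d), ← Real.rpow_mul hK, Nat.cast_pow,
          mul_one_div_cancel hNd.ne', Real.rpow_one]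

/-- ★ **(3.26) from the one-axis wall-pattern bounds**: if, in the box of even side `L_s = 2n+2 ≥ 4`
(`J_E, J_M ≥ 0`, `0 ≤ K ≤ 1`), for every axis `i` the event "every bond `⟨y, y+e_i⟩` is a domain wall" has
probability `≤ K^{d·L_s^d}`, then EVERY bond set `B` carries walls with probability `≤ K^{|B|}`: the walls of `B`
along a busiest axis `i₀` (`d·|B_{i₀}| ≥ |B|`) dominate the indicator, the bond chessboard of §5 bounds them by the
full pattern to the power `|B_{i₀}|/L_s^d`, and `K ≤ 1`. [cite: TomboulisYaffe1985, §III.C eqs. (3.10), (3.24), (3.26) (pp. 323–325); §III.B eq. (3.6) (p. 322)] -/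
theorem expectation_wallEvent_le_of_patternBound (hn : 1 ≤ n) {L : ℕ} [NeZero L] (hL : L = 2 * n + 2)
    {JE JM K : ℝ} (hJE : 0 ≤ JE) (hJM : 0 ≤ JM) (hK0 : 0 ≤ K) (hK1 : K ≤ 1)
    (h : ∀ i : Fin d, expectation (fundamentalRep (Fin 2)) JE JM
      ((wallEvent (d := d) (L₀ := L₀) (L := L) ((Finset.univ : Finset (Fin d → ZMod L)) ×ˢ {i})).indicator 1) ≤
        K ^ (d * L ^ d))
    (B : Finset ((Fin d → ZMod L) × Fin d)) :
    expectation (fundamentalRep (Fin 2)) JE JM ((wallEvent (d := d) (L₀ := L₀) (L := L) B).indicator 1) ≤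
      K ^ B.card := by
  subst hL
  classical
  have hρc := continuous_fundamentalRep (Fin 2)
  have hZ := partitionFunction_pos (d := d) (L₀ := L₀) (L := 2 * n + 2) (fundamentalRep (Fin 2)) hρc JE JM
  rcases Nat.eq_zero_or_pos d with hd | hd
  · -- no spatial direction, no bond
    subst hd
    have hB : B = ∅ := Finset.eq_empty_of_forall_notMem fun b _ => b.2.elim0
    subst hB
    have he : (wallEvent (d := 0) (L₀ := L₀) (L := 2 * n + 2) (∅ : Finset ((Fin 0 → ZMod (2 * n + 2)) × Fin 0))).indicator
        (1 : Config 0 L₀ (2 * n + 2) SU2 → ℝ) = fun _ => 1 := by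
      funext U
      rw [Set.indicator_of_mem]
      · rfl
      · intro b hb; simp at hb
    rw [he, expectation_const _ hZ, Finset.card_empty, pow_zero]
  · -- the bonds of `B` along each axis, listed by base point
    set T : Fin d → Finset (Fin d → ZMod (2 * n + 2)) := fun i => (B.filter fun b => b.2 = i).image Prod.fst with hT
    have hTcard : ∀ i, (T i).card = (B.filter fun b => b.2 = i).card := fun i => by
      refine Finset.card_image_of_injOn fun b hb b' hb' hbb => ?_
      have h2 := (Finset.mem_filter.1 hb).2
      have h2' := (Finset.mem_filter.1 hb').2
      exact Prod.ext hbb (h2.trans h2'.symm)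
    have hsum : B.card = ∑ i, (T i).card := by
      rw [Finset.card_eq_sum_card_fiberwise (f := Prod.snd) (t := Finset.univ) fun _ _ => Finset.mem_univ _]
      exact Finset.sum_congr rfl fun i _ => (hTcard i).symm
    -- a busiest axis
    obtain ⟨i₀, -, hi₀⟩ := Finset.exists_max_image (Finset.univ : Finset (Fin d)) (fun i => (T i).card)
      ⟨⟨0, hd⟩, Finset.mem_univ _⟩
    have hcard : B.card ≤ d * (T i₀).card := by
      rw [hsum]
      calc ∑ i, (T i).card ≤ ∑ _i : Fin d, (T i₀).card := Finset.sum_le_sum fun i _ => hi₀ i (Finset.mem_univ i)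
        _ = d * (T i₀).card := by simp
    -- the symmetric wall function of a pair of Polyakov loops
    set η : SU2 → ℝ := fun g => ((fundamentalRep (Fin 2) g).trace.re) / 2 with hη
    set S : Set (SU2 × SU2) := {p | ¬ (0 ≤ η p.1 ↔ 0 ≤ η p.2)} with hS
    set w : SU2 → SU2 → ℝ := fun a b => S.indicator 1 (a, b) with hw
    have hηc : Continuous η := (Complex.continuous_re.comp (continuous_fundamentalRep (Fin 2)).matrix_trace).div_const 2
    have hSm : MeasurableSet S := by
      have e : S = symmDiff {p : SU2 × SU2 | 0 ≤ η p.1} {p | 0 ≤ η p.2} := by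
        ext p; simp only [hS, Set.mem_setOf_eq, Set.mem_symmDiff]; tauto
      rw [e]
      exact ((isClosed_le continuous_const (hηc.comp continuous_fst)).measurableSet).symmDiff
        ((isClosed_le continuous_const (hηc.comp continuous_snd)).measurableSet)
    have hwm : Measurable (Function.uncurry w) := by
      have e : Function.uncurry w = S.indicator 1 := by funext p; rfl
      rw [e]; exact measurable_one.indicator hSm
    have hw01 : ∀ a b, 0 ≤ w a b ∧ w a b ≤ 1 := fun a b => by
      by_cases hp : (a, b) ∈ S
      · simp [hw, Set.indicator_of_mem hp]
      · simp [hw, Set.indicator_of_notMem hp]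
    have hws : ∀ a b, w a b = w b a := fun a b => by
      have hiff : ((a, b) ∈ S) ↔ ((b, a) ∈ S) := by simp only [hS, Set.mem_setOf_eq]; tauto
      by_cases hp : (a, b) ∈ S
      · simp only [hw, Set.indicator_of_mem hp, Set.indicator_of_mem (hiff.1 hp), Pi.one_apply]
      · simp only [hw, Set.indicator_of_notMem hp, Set.indicator_of_notMem (fun h' => hp (hiff.2 h'))]
    have hηΩ : ∀ (U : Config d L₀ (2 * n + 2) SU2) (y : Fin d → ZMod (2 * n + 2)),
        η (polyakovLine U y) = halfTrace U y := fun U y => rfl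
    have hwval : ∀ (U : Config d L₀ (2 * n + 2) SU2) (y y' : Fin d → ZMod (2 * n + 2)),
        w (polyakovLine U y) (polyakovLine U y') =
          if (0 ≤ halfTrace U y ↔ 0 ≤ halfTrace U y') then 0 else 1 := fun U y y' => by
      by_cases hc : (0 ≤ halfTrace U y ↔ 0 ≤ halfTrace U y')
      · have : (polyakovLine U y, polyakovLine U y') ∉ S := fun hmem => hmem hc
        rw [if_pos hc, hw]; simp only [Set.indicator_of_notMem this]
      · have : (polyakovLine U y, polyakovLine U y') ∈ S := hc
        rw [if_neg hc, hw]; simp only [Set.indicator_of_mem this, Pi.one_apply]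
    -- the full product of `w` along the axis `i` is the indicator of the one-axis wall pattern
    have hfull : ∀ i : Fin d, (fun U : Config d L₀ (2 * n + 2) SU2 =>
        ∏ c : Fin d → ZMod (2 * n + 2), w (polyakovLine U c) (polyakovLine U (c + Pi.single i 1))) =
        (wallEvent ((Finset.univ : Finset (Fin d → ZMod (2 * n + 2))) ×ˢ {i})).indicator 1 := by
      intro i; funext U
      simp only [hwval]
      by_cases hU : U ∈ wallEvent ((Finset.univ : Finset (Fin d → ZMod (2 * n + 2))) ×ˢ {i})
      · rw [Set.indicator_of_mem hU, Pi.one_apply]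
        refine Finset.prod_eq_one fun c _ => ?_
        rw [if_neg (hU (c, i) (Finset.mem_product.2 ⟨Finset.mem_univ _, Finset.mem_singleton_self _⟩))]
      · rw [Set.indicator_of_notMem hU]
        simp only [wallEvent, Set.mem_setOf_eq, not_forall, not_not, exists_prop] at hU
        obtain ⟨b, hb, hbw⟩ := hU
        obtain ⟨-, hbi⟩ := Finset.mem_product.1 hb
        rw [Finset.mem_singleton] at hbi
        refine Finset.prod_eq_zero (Finset.mem_univ b.1) ?_
        rw [← hbi, if_pos hbw]
    -- pointwise: the wall indicator of `B` is dominated by the walls of `B` along `i₀`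
    have hpt : ∀ U : Config d L₀ (2 * n + 2) SU2, (wallEvent B).indicator (1 : Config d L₀ (2 * n + 2) SU2 → ℝ) U ≤
        ∏ c ∈ T i₀, w (polyakovLine U c) (polyakovLine U (c + Pi.single i₀ 1)) := fun U => by
      by_cases hU : U ∈ wallEvent B
      · rw [Set.indicator_of_mem hU, Pi.one_apply]
        refine le_of_eq (Finset.prod_eq_one fun c hc => ?_).symm
        obtain ⟨b, hb, rfl⟩ := Finset.mem_image.1 hc
        obtain ⟨hbB, hbi⟩ := Finset.mem_filter.1 hb
        rw [hwval, if_neg]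
        have := hU b hbB
        rwa [hbi] at this
      · rw [Set.indicator_of_notMem hU]
        exact Finset.prod_nonneg fun c _ => (hw01 _ _).1
    -- positivity of the pattern and the bond chessboard
    have hposW := expectation_wallPattern_pos (d := d) (L₀ := L₀) (n := n) JE JM i₀
    have hpos : 0 < expectation (fundamentalRep (Fin 2)) JE JM (fun U : Config d L₀ (2 * n + 2) SU2 =>
        ∏ c : Fin d → ZMod (2 * n + 2), w (polyakovLine U c) (polyakovLine U (c + Pi.single i₀ 1))) := by
      rw [hfull]; exact hposW
    have hchess := expectation_polyakovBondProd_le_rpow (L₀ := L₀) (fundamentalRep (Fin 2))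
      fundamentalRep_mem_unitaryGroup hρc hn hJE hJM i₀ hwm hw01 hws hpos (T i₀)
    rw [hfull i₀] at hchess
    -- integrability for the monotonicity step
    have hint1 : Integrable (fun U => (wallEvent B).indicator (1 : Config d L₀ (2 * n + 2) SU2 → ℝ) U *
        weight (fundamentalRep (Fin 2)) JE JM U) (haar d L₀ (2 * n + 2) SU2) := by
      refine integrable_mul_weight (fundamentalRep (Fin 2)) hρc JE JM
        ((aestronglyMeasurable_indicator_iff (measurableSet_wallEvent' B)).2 aestronglyMeasurable_const) (C := 1)
        fun U => ?_
      by_cases hU : U ∈ wallEvent B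
      · rw [Set.indicator_of_mem hU]; simp
      · rw [Set.indicator_of_notMem hU]; simp
    have hint2 : Integrable (fun U => (∏ c ∈ T i₀, w (polyakovLine U c) (polyakovLine U (c + Pi.single i₀ 1))) *
        weight (fundamentalRep (Fin 2)) JE JM U) (haar d L₀ (2 * n + 2) SU2) :=
      integrable_mul_weight (fundamentalRep (Fin 2)) hρc JE JM
        (measurable_bondProd (T i₀) id (fun c => c + Pi.single i₀ 1) hwm).aestronglyMeasurable (C := 1) fun U =>
          have hm := bondProd_mem (L₀ := L₀) (T i₀) id (fun c => c + Pi.single i₀ 1) hw01 U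
          abs_le.2 ⟨(neg_nonpos.2 zero_le_one).trans hm.1, hm.2⟩
    have hNd : ((2 * n + 2 : ℕ) : ℝ) ^ d ≠ 0 := by positivity
    have hz0 : (0 : ℝ) ≤ ((T i₀).card : ℝ) / ((2 * n + 2 : ℕ) : ℝ) ^ d :=
      div_nonneg (Nat.cast_nonneg _) (pow_nonneg (Nat.cast_nonneg _) _)
    have hstep : expectation (fundamentalRep (Fin 2)) JE JM
          ((wallEvent ((Finset.univ : Finset (Fin d → ZMod (2 * n + 2))) ×ˢ {i₀})).indicator 1) ^
          (((T i₀).card : ℝ) / ((2 * n + 2 : ℕ) : ℝ) ^ d) ≤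
        (K ^ (d * (2 * n + 2) ^ d)) ^ (((T i₀).card : ℝ) / ((2 * n + 2 : ℕ) : ℝ) ^ d) :=
      Real.rpow_le_rpow hposW.le (h i₀) hz0
    have halg : (K ^ (d * (2 * n + 2) ^ d)) ^ (((T i₀).card : ℝ) / ((2 * n + 2 : ℕ) : ℝ) ^ d) =
        K ^ (d * (T i₀).card) := by
      rw [← Real.rpow_natCast K (d * (2 * n + 2) ^ d), ← Real.rpow_mul hK0, ← Real.rpow_natCast K (d * (T i₀).card)]
      congr 1
      rw [Nat.cast_mul, Nat.cast_pow, Nat.cast_mul, mul_assoc, ← mul_div_assoc, mul_div_cancel_left₀ _ hNd]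
    calc expectation (fundamentalRep (Fin 2)) JE JM ((wallEvent B).indicator 1)
        ≤ expectation (fundamentalRep (Fin 2)) JE JM (fun U : Config d L₀ (2 * n + 2) SU2 =>
            ∏ c ∈ T i₀, w (polyakovLine U c) (polyakovLine U (c + Pi.single i₀ 1))) :=
          expectation_mono_of_integrable (fundamentalRep (Fin 2)) hρc JE JM hint1 hint2 hpt
      _ ≤ expectation (fundamentalRep (Fin 2)) JE JM
            ((wallEvent ((Finset.univ : Finset (Fin d → ZMod (2 * n + 2))) ×ˢ {i₀})).indicator 1) ^
            (((T i₀).card : ℝ) / ((2 * n + 2 : ℕ) : ℝ) ^ d) := hchess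
      _ ≤ (K ^ (d * (2 * n + 2) ^ d)) ^ (((T i₀).card : ℝ) / ((2 * n + 2 : ℕ) : ℝ) ^ d) := hstep
      _ = K ^ (d * (T i₀).card) := halg
      _ ≤ K ^ B.card := pow_le_pow_of_le_one hK0 hK1 hcard

/-- ★★ **Tomboulis–Yaffe's disorder bounds (3.25)–(3.26) — the hypothesis `X` of
`polyakovTwoPointLowerBound_of_disorderBounds` ∕ `magneticFluxFreeEnergyBound_of_disorderBounds` — from two
full-lattice PATTERN BOUNDS along the high-temperature hyperbola `(J_E, J_M) = (γθ, γ/θ)`:** for every `γ > 0`,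
`d ≥ 2`, `L₀ = 2^a`, above a threshold and with a rate `K(θ) → 0`, uniformly in `L_s = 2^k ≥ 4`,
`⟨∏_x (1 − |½trΩ[x]|)⟩ ≤ K^{L_s^d}` (TY (3.23)) and, for each axis `i`, `⟨all bonds ⟨y,y+e_i⟩ are walls⟩ ≤ K^{d L_s^d}`
(one-axis form of TY (3.24)). The chessboard estimates (3.9)–(3.10) are now PROVED (§§3, 5); what is assumed is
the thermodynamic estimate of TY (3.11)–(3.24) (App. III–IV). [cite: TomboulisYaffe1985, §III.C eqs. (3.9)–(3.10), (3.23)–(3.26) (pp. 323–325)] -/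
theorem disorderBounds_of_patternBounds
    (h : ∀ γ : ℝ, 0 < γ → ∀ d : ℕ, 2 ≤ d → ∀ a : ℕ,
      ∃ θ₀ : ℝ, ∃ K : ℝ → ℝ, Tendsto K atTop (𝓝 0) ∧
        ∀ θ : ℝ, θ₀ < θ → ∀ k : ℕ, 2 ≤ k →
          expectation (d := d) (L₀ := 2 ^ a) (L := 2 ^ k) (fundamentalRep (Fin 2)) (γ * θ) (γ / θ)
              (fun U => ∏ x, (1 - |halfTrace U x|)) ≤ K θ ^ (2 ^ k) ^ d ∧
          ∀ i : Fin d, expectation (d := d) (L₀ := 2 ^ a) (L := 2 ^ k) (fundamentalRep (Fin 2)) (γ * θ) (γ / θ)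
              ((wallEvent ((Finset.univ : Finset (Fin d → ZMod (2 ^ k))) ×ˢ {i})).indicator 1) ≤
            K θ ^ (d * (2 ^ k) ^ d)) :
    ∀ γ : ℝ, 0 < γ → ∀ d : ℕ, 2 ≤ d → ∀ a : ℕ,
      ∃ θ₀ : ℝ, ∃ K : ℝ → ℝ, Tendsto K atTop (𝓝 0) ∧
        ∀ θ : ℝ, θ₀ < θ → ∀ k : ℕ, 2 ≤ k →
          expectation (d := d) (L₀ := 2 ^ a) (L := 2 ^ k) (fundamentalRep (Fin 2)) (γ * θ) (γ / θ)
              (fun U => 1 - |halfTrace U 0|) ≤ K θ ∧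
          ∀ B : Finset ((Fin d → ZMod (2 ^ k)) × Fin d),
            expectation (d := d) (L₀ := 2 ^ a) (L := 2 ^ k) (fundamentalRep (Fin 2)) (γ * θ) (γ / θ)
              ((wallEvent B).indicator 1) ≤ K θ ^ B.card := by
  intro γ hγ d hd a
  obtain ⟨θ₀, K, hK, hθ⟩ := h γ hγ d hd a
  -- above `θ₁` the rate is `< 1`
  obtain ⟨θ₁, hθ₁⟩ := eventually_atTop.1 ((hK.abs).eventually (gt_mem_nhds (by simp : |(0:ℝ)| < 1)))
  refine ⟨max θ₀ (max θ₁ 0), fun θ => |K θ|, by simpa using hK.abs, fun θ hθθ k hk => ?_⟩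
  have hθ0 : θ₀ < θ := lt_of_le_of_lt (le_max_left _ _) hθθ
  have hθ1 : θ₁ ≤ θ := ((le_max_left _ _).trans (le_max_right θ₀ _)).trans hθθ.le
  have hθpos : 0 < θ := lt_of_le_of_lt ((le_max_right _ _).trans (le_max_right θ₀ _)) hθθ
  have hJE : 0 ≤ γ * θ := (mul_pos hγ hθpos).le
  have hJM : 0 ≤ γ / θ := (div_pos hγ hθpos).le
  have hK1 : |K θ| ≤ 1 := (hθ₁ θ hθ1).le
  have hK0 : 0 ≤ |K θ| := abs_nonneg _
  obtain ⟨hpt, hwall⟩ := hθ θ hθ0 k hk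
  -- the box `L = 2^k = 2n + 2` with `n = 2^{k-1} - 1 ≥ 1`
  obtain ⟨m, rfl⟩ : ∃ m, k = m + 2 := ⟨k - 2, by omega⟩
  have h2 : 2 ≤ 2 ^ (m + 1) := by
    calc 2 = 2 ^ 1 := (pow_one 2).symm
      _ ≤ 2 ^ (m + 1) := Nat.pow_le_pow_right (by norm_num) (by omega)
  have hp : 2 ^ (m + 2) = 2 * (2 ^ (m + 1) - 1) + 2 := by rw [pow_succ]; omega
  constructor
  · refine expectation_pointDefect_le_of_patternBound (n := 2 ^ (m + 1) - 1) hp hJE hJM hK0 ?_ 0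
    exact hpt.trans ((le_abs_self _).trans_eq (abs_pow _ _))
  · intro B
    refine expectation_wallEvent_le_of_patternBound (n := 2 ^ (m + 1) - 1) (by omega) hp hJE hJM hK0 hK1 ?_ B
    intro i
    exact (hwall i).trans ((le_abs_self _).trans_eq (abs_pow _ _))

/-- The number of sites of Borgs–Seiler's lattice `ℤ_{L₀} × (ℤ/L)^d`. [folklore] -/
private theorem card_site (d L₀ L : ℕ) [NeZero L₀] [NeZero L] :
    Fintype.card (FiniteTemperature.Site d L₀ L) = L₀ * L ^ d := by
  simp [FiniteTemperature.Site, Fintype.card_prod, ZMod.card, Fintype.card_pi]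

/-- ★★ **The pattern bounds may be taken at zero magnetic coupling.** If for every `d ≥ 2` and `L₀ = 2^a` there are
a threshold `J₀` and a rate `K(J) → 0` (`J → ∞`) such that at couplings `(J_E, J_M) = (J, 0)` and for all
`L_s = 2^k ≥ 4`, `⟨∏_x (1 − |½trΩ[x]|)⟩ ≤ K(J)^{L_s^d}` and `⟨all bonds along the axis i are walls⟩ ≤ K(J)^{d L_s^d}`,
then the same pattern bounds hold along every hyperbola `(γθ, γ/θ)` with the rate
`e^{4(γ/θ) L₀ #{i<j}} |K(γθ)| → 0` (`expectation_le_exp_mul_expectation_electric`), hence (by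
`disorderBounds_of_patternBounds`) TY's disorder bounds (3.25)–(3.26) hold. At `J_M = 0` the space-like links
integrate exactly (TY (3.16): "At this point, one can exactly integrate over the remaining spacelike link
variables"), leaving an `SU(2)`-spin model of Polyakov loops. [cite: TomboulisYaffe1985, §III.C eqs. (3.16)–(3.17) (p. 324); App. III.A (p. 334)] -/
theorem disorderBounds_of_electricPatternBounds
    (h : ∀ d : ℕ, 2 ≤ d → ∀ a : ℕ, ∃ J₀ : ℝ, ∃ K : ℝ → ℝ, Tendsto K atTop (𝓝 0) ∧
      ∀ J : ℝ, J₀ < J → ∀ k : ℕ, 2 ≤ k →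
        expectation (d := d) (L₀ := 2 ^ a) (L := 2 ^ k) (fundamentalRep (Fin 2)) J 0
            (fun U => ∏ x, (1 - |halfTrace U x|)) ≤ K J ^ (2 ^ k) ^ d ∧
        ∀ i : Fin d, expectation (d := d) (L₀ := 2 ^ a) (L := 2 ^ k) (fundamentalRep (Fin 2)) J 0
            ((wallEvent ((Finset.univ : Finset (Fin d → ZMod (2 ^ k))) ×ˢ {i})).indicator 1) ≤
          K J ^ (d * (2 ^ k) ^ d)) :
    ∀ γ : ℝ, 0 < γ → ∀ d : ℕ, 2 ≤ d → ∀ a : ℕ,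
      ∃ θ₀ : ℝ, ∃ K : ℝ → ℝ, Tendsto K atTop (𝓝 0) ∧
        ∀ θ : ℝ, θ₀ < θ → ∀ k : ℕ, 2 ≤ k →
          expectation (d := d) (L₀ := 2 ^ a) (L := 2 ^ k) (fundamentalRep (Fin 2)) (γ * θ) (γ / θ)
              (fun U => 1 - |halfTrace U 0|) ≤ K θ ∧
          ∀ B : Finset ((Fin d → ZMod (2 ^ k)) × Fin d),
            expectation (d := d) (L₀ := 2 ^ a) (L := 2 ^ k) (fundamentalRep (Fin 2)) (γ * θ) (γ / θ)
              ((wallEvent B).indicator 1) ≤ K θ ^ B.card := by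
  refine disorderBounds_of_patternBounds fun γ hγ d hd a => ?_
  obtain ⟨J₀, K, hK, hJ⟩ := h d hd a
  have hρc := continuous_fundamentalRep (Fin 2)
  -- the constant in the exponent: `c(θ) = 4 (γ/θ) 2^a #{i<j}`
  set Cd : ℝ := (Fintype.card {p : Fin d × Fin d // p.1 < p.2} : ℝ) with hCd
  set c : ℝ → ℝ := fun θ => 4 * (γ / θ) * (2 ^ a : ℝ) * Cd with hc
  refine ⟨max (J₀ / γ) 1, fun θ => Real.exp (c θ) * |K (γ * θ)|, ?_, fun θ hθθ k hk => ?_⟩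
  · -- the rate tends to `e^0 · 0 = 0`
    have h1 : Tendsto (fun θ : ℝ => γ / θ) atTop (𝓝 0) := tendsto_const_nhds.div_atTop tendsto_id
    have h2 : Tendsto c atTop (𝓝 (4 * 0 * (2 ^ a : ℝ) * Cd)) :=
      ((tendsto_const_nhds.mul h1).mul tendsto_const_nhds).mul tendsto_const_nhds
    rw [mul_zero, zero_mul, zero_mul] at h2
    have h3 : Tendsto (fun θ => Real.exp (c θ)) atTop (𝓝 (Real.exp 0)) := (Real.continuous_exp.tendsto 0).comp h2
    rw [Real.exp_zero] at h3
    have h4 : Tendsto (fun θ => |K (γ * θ)|) atTop (𝓝 0) := by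
      simpa using (hK.comp (tendsto_id.const_mul_atTop hγ)).abs
    simpa using h3.mul h4
  · have hθ1 : 1 ≤ θ := (le_max_right _ _).trans hθθ.le
    have hθpos : 0 < θ := lt_of_lt_of_le one_pos hθ1
    have hJ₀ : J₀ < γ * θ := by
      have := lt_of_le_of_lt (le_max_left _ _) hθθ
      rw [div_lt_iff₀ hγ] at this
      linarith [mul_comm θ γ]
    have hJM : 0 ≤ γ / θ := (div_pos hγ hθpos).le
    obtain ⟨hpt, hwall⟩ := hJ (γ * θ) hJ₀ k hk
    -- the magnetic-removal factor in the box `L = 2^k`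
    have hM : (2 : ℝ) * (γ / θ) * (2 * (Fintype.card (FiniteTemperature.Site d (2 ^ a) (2 ^ k)) *
        Fintype.card {p : Fin d × Fin d // p.1 < p.2})) = c θ * (2 ^ k : ℝ) ^ d := by
      rw [card_site, hc, hCd]; push_cast; ring
    have hc0 : 0 ≤ c θ := by rw [hc, hCd]; positivity
    have hfac : ∀ F : Config d (2 ^ a) (2 ^ k) SU2 → ℝ, AEStronglyMeasurable F (haar d (2 ^ a) (2 ^ k) SU2) →
        (∀ U, |F U| ≤ 1) → (∀ U, 0 ≤ F U) →
        expectation (fundamentalRep (Fin 2)) (γ * θ) (γ / θ) F ≤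
          Real.exp (c θ * (2 ^ k : ℝ) ^ d) * expectation (fundamentalRep (Fin 2)) (γ * θ) 0 F := by
      intro F hFm hFb hF0
      have := expectation_le_exp_mul_expectation_electric (d := d) (L₀ := 2 ^ a) (L := 2 ^ k)
        (fundamentalRep (Fin 2)) fundamentalRep_mem_unitaryGroup hρc (JE := γ * θ) hJM hFm hFb hF0
      rwa [Nat.cast_ofNat, hM] at this
    have hKabs : ∀ m : ℕ, K (γ * θ) ^ m ≤ |K (γ * θ)| ^ m := fun m => (le_abs_self _).trans_eq (abs_pow _ _)
    have hexp_pow : ∀ m : ℕ, Real.exp (c θ * m) = Real.exp (c θ) ^ m := fun m => by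
      rw [mul_comm, Real.exp_nat_mul]
    constructor
    · -- the point pattern
      have hFm : AEStronglyMeasurable (fun U : Config d (2 ^ a) (2 ^ k) SU2 => ∏ x, (1 - |halfTrace U x|))
          (haar d (2 ^ a) (2 ^ k) SU2) :=
        (continuous_finsetProd _ fun x _ => continuous_const.sub (continuous_halfTrace' x).abs).aestronglyMeasurable
      have hF01 : ∀ U : Config d (2 ^ a) (2 ^ k) SU2, 0 ≤ ∏ x, (1 - |halfTrace U x|) ∧ ∏ x, (1 - |halfTrace U x|) ≤ 1 :=
        fun U => ⟨Finset.prod_nonneg fun x _ => by have := abs_halfTrace_le_one U x; linarith,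
          Finset.prod_le_one (fun x _ => by have := abs_halfTrace_le_one U x; linarith)
            fun x _ => by have := abs_nonneg (halfTrace U x); linarith⟩
      refine (hfac _ hFm (fun U => abs_le.2 ⟨(neg_nonpos.2 zero_le_one).trans (hF01 U).1, (hF01 U).2⟩)
        (fun U => (hF01 U).1)).trans ?_
      calc Real.exp (c θ * (2 ^ k : ℝ) ^ d) * expectation (fundamentalRep (Fin 2)) (γ * θ) 0
              (fun U : Config d (2 ^ a) (2 ^ k) SU2 => ∏ x, (1 - |halfTrace U x|))
          ≤ Real.exp (c θ * (2 ^ k : ℝ) ^ d) * |K (γ * θ)| ^ (2 ^ k) ^ d :=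
            mul_le_mul_of_nonneg_left (hpt.trans (hKabs _)) (Real.exp_pos _).le
        _ = (Real.exp (c θ) * |K (γ * θ)|) ^ (2 ^ k) ^ d := by
            rw [mul_pow, ← hexp_pow]; push_cast; ring_nf
    · -- the one-axis wall patterns
      intro i
      have hE := measurableSet_wallEvent' (d := d) (L₀ := 2 ^ a) (L := 2 ^ k)
        ((Finset.univ : Finset (Fin d → ZMod (2 ^ k))) ×ˢ {i})
      have hFm := (aestronglyMeasurable_indicator_iff (μ := haar d (2 ^ a) (2 ^ k) SU2) hE).2
        (aestronglyMeasurable_const (b := (1 : ℝ)))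
      have hF01 : ∀ U : Config d (2 ^ a) (2 ^ k) SU2,
          0 ≤ (wallEvent ((Finset.univ : Finset (Fin d → ZMod (2 ^ k))) ×ˢ {i})).indicator
              (1 : Config d (2 ^ a) (2 ^ k) SU2 → ℝ) U ∧
          (wallEvent ((Finset.univ : Finset (Fin d → ZMod (2 ^ k))) ×ˢ {i})).indicator
              (1 : Config d (2 ^ a) (2 ^ k) SU2 → ℝ) U ≤ 1 := fun U => by
        by_cases hU : U ∈ wallEvent ((Finset.univ : Finset (Fin d → ZMod (2 ^ k))) ×ˢ {i})
        · rw [Set.indicator_of_mem hU]; simp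
        · rw [Set.indicator_of_notMem hU]; simp
      refine (hfac _ hFm (fun U => abs_le.2 ⟨(neg_nonpos.2 zero_le_one).trans (hF01 U).1, (hF01 U).2⟩)
        (fun U => (hF01 U).1)).trans ?_
      have hd1 : (1 : ℝ) ≤ d := by exact_mod_cast (show 1 ≤ d by omega)
      calc Real.exp (c θ * (2 ^ k : ℝ) ^ d) * expectation (fundamentalRep (Fin 2)) (γ * θ) 0
              ((wallEvent ((Finset.univ : Finset (Fin d → ZMod (2 ^ k))) ×ˢ {i})).indicator 1)
          ≤ Real.exp (c θ * (2 ^ k : ℝ) ^ d) * |K (γ * θ)| ^ (d * (2 ^ k) ^ d) :=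
            mul_le_mul_of_nonneg_left ((hwall i).trans (hKabs _)) (Real.exp_pos _).le
        _ ≤ Real.exp (c θ * (d * (2 ^ k) ^ d : ℕ)) * |K (γ * θ)| ^ (d * (2 ^ k) ^ d) := by
            refine mul_le_mul_of_nonneg_right (Real.exp_le_exp.2 ?_) (pow_nonneg (abs_nonneg _) _)
            push_cast
            have : 0 ≤ c θ * (2 ^ k : ℝ) ^ d := by positivity
            nlinarith
        _ = (Real.exp (c θ) * |K (γ * θ)|) ^ (d * (2 ^ k) ^ d) := by
            rw [mul_pow, ← hexp_pow]

end SU2Reduction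







end TomboulisYaffeHighTemperature

end Literature.MathematicalPhysics.QuantumFieldTheory
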